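import Literature.Combinatorics.Optimization.CompletelyPsdRank
import HarnessLib

/-!
# Quantum behaviours as affine sections of the cpsd cone and `𝒟(p)` as a cpsd-rank
# (Prakash–Sikora–Varvitsiotis–Wei 2017, Theorems 1–2 and Proposition 1, after Sikora–Varvitsiotis)

Sources. A. Prakash, J. Sikora, A. Varvitsiotis, Z. Wei, *Completely positive semidefinite rank*,
Math. Program. 171 (2018) 397–431 = arXiv:1604.07199 [PrakashEtAl2017] (held text
`paper:arxiv-1604.07199`, `pNN` = chunk; Theorem 1, Theorem 2, Proposition 1 and the definitions of a
`d`-dimensional representation, `𝒟(p)`, local behaviours and `𝒜(p)` are on p04–p05), which restates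
J. Sikora, A. Varvitsiotis, *Linear conic formulations for two-party correlations and values of
nonlocal games*, Math. Program. 162 (2017) 431–463 = arXiv:1506.07297 [SikoraVarvitsiotis2016]
(held text `paper:arxiv-1506.07297`: Lemma 3.1, Theorem 3.2 + Remark 3.3 (p11), Theorem 3.5,
Lemma 3.6 (p12), Theorems 3.7–3.8 (p13), all with printed proofs, followed here) and the dimension
count of J. Sikora, A. Varvitsiotis, Z. Wei, Phys. Rev. Lett. 117 (2016) 060401 = arXiv:1507.00213
[SikoraVarvitsiotisWei2016] (p03: mixed states may be assumed pure in the same dimension).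
Also S. Gribling, D. de Laat, M. Laurent, Linear Algebra Appl. 513 (2017) 122–148 = arXiv:1605.00988
[GriblingDelaatLaurent2017] (held text `paper:arxiv-1605.00988`, §5 p16: the pure-state form, Theorem
5.1). Companion of `CompletelyPsdRank.lean` (same directory), whose module docstring listed Theorems
1, 2 and Proposition 1 — "the Bell-scenario / quantum-behavior formalism `𝒟(p)`" — as NOT typed;
this file types AND proves them (no new named fact is left undischarged).

Contents (all PROVED; the three printed statements are also recorded as named `Prop`s with
`_holds` discharges, `PrakashEtAl2017_thm1` / `_thm2` / `_prop1`):
* vocabulary (PSVW p04–p05): `HasQuantumRep p d` (a `d`-dimensional representation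
  `p(ab|xy) = Tr((M_{a|x} ⊗ N_{b|y})ρ)`, `ρ` a density matrix on `ℂ^d ⊗ ℂ^d`, POVMs of Hermitian psd
  `d × d` matrices), `quantumBehaviors` (`𝒬`), `quantumDim` (`𝒟(p)`), `localBehaviors` (`ℒ`, LHV
  models), `BellIndex` (the index set `([m_A]×[o_A]) ∪ ([m_B]×[o_B])`), `behaviorAffine` (`𝒜(p)`,
  conditions (1)–(4));
* the dimension-exact dictionary `hasQuantumRep_iff` (`d ≥ 1`): `p` has a `d`-dimensional
  representation iff some `R ∈ 𝒜(p)` has a `CS_+`-factorization of size `d` — directions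
  `exists_cpsd_of_hasQuantumRep` (SV Thm 3.2 (i)⇒(ii) + Lemma 3.6 (a)) and
  `hasPureQuantumRep_of_factors` / `hasQuantumRep_of_factors` (SV Thm 3.2 (ii)⇒(i) + Remark 3.3);
  the pure-state notion `HasPureQuantumRep` (GdLL §5) with **GdLL Theorem 5.1**
  (`GriblingDelaatLaurent2017_thm51`) and "pure states suffice in the same dimension"
  (`hasPureQuantumRep_iff_hasQuantumRep`, [SVW16] p03; appended);
* **Theorem 1**: `mem_quantumBehaviors_iff` (`𝒬 = Corr(CS_+)`) and `mem_localBehaviors_iff`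
  (`ℒ = Corr(CP)`, SV Thm 3.5), `localBehaviors_subset_quantumBehaviors`, and no-signaling of `𝒬`
  (`noSignaling_of_mem_quantumBehaviors`, SV Thm 3.8 for `𝒬`); appended: SV Theorem 3.8 in the form
  its proof gives (`noSignaling_of_posSemidef_mem_behaviorAffine`: a psd matrix in `𝒜(p)` forces
  no-signaling) and Proposition 3.11 `𝒬 ⊆ Corr(DNN) ⊆ NS`
  (`exists_isDnn_mem_behaviorAffine_of_mem_quantumBehaviors`, `noSignaling_of_isDnn_mem_behaviorAffine`);
* **Theorem 2**: `isLeast_quantumDim` (`𝒟(p) = min{cpsd-rank R : R ∈ CS_+ ∩ 𝒜(p)}`, typed as: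
  `𝒟(p)` is the least `d ≥ 1` such that some `R ∈ 𝒜(p)` has a `CS_+`-factorization of size `d`),
  with the inequality form `quantumDim_le_of_hasCpsdFactorization` ("`cpsd-rank(R) ≥ 𝒟(p)`", the
  form used on p06 and in §5) and attainment `exists_hasCpsdFactorization_quantumDim`;
* **Proposition 1** (i) `quantumDim_bounded_of_cpsdRank_bounded`, (ii)
  `quantumDim_unbounded_of_cpsdRank_unbounded`.

Design choices / deviations from the printed proofs (recorded, not weakenings).
* MIXED STATES. PSVW define representations with a density matrix `ρ`; SV work with pure states and
  a Schmidt decomposition (Lemma 3.1), and [SVW16, p03] reduce mixed to pure by purification and a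
  compression to the Schmidt support. Here the direction "representation ⇒ cpsd factors of the same
  size `d`" is done for a general `ρ` at once through the reduced operators
  `Φ_ρ(N) = Tr_B((I ⊗ N)ρ)` (`CpsdFormulation.ptrB`): with `A = Φ_ρ(I)` the reduced state,
  `X_{xa} = A^{1/4} M_{a|x} A^{1/4}`, `Y_{yb} = A^{-1/4} Φ_ρ(N_{b|y}) A^{-1/4}` (pseudo-inverse roots),
  all row sums equal `K = A^{1/2}`, `Tr K² = Tr ρ = 1`, and `Tr(X_{xa}Y_{yb}) = Tr(M_{a|x} Φ_ρ(N_{b|y}))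
  = p(ab|xy)` because `0 ⪯ Φ_ρ(N_{b|y}) ⪯ A` lives on the support of `A`. For `ρ = ψψ*` in Schmidt
  form this is exactly SV's `X = K^{1/2} M K^{1/2}`, `Y = K^{1/2} Nᵀ K^{1/2}`; no singular value /
  Schmidt decomposition is needed.
* "WITHOUT LOSS OF GENERALITY `K` HAS FULL RANK" (SV p11) is replaced by pseudo-inverse square roots
  of `K` plus a completion of the POVMs by `I − P` off the support projection `P` of `K`
  (`hasQuantumRep_of_factors`); the state is `vec(K)vec(K)*` as printed.
* The functional calculus used is Mathlib's `Matrix.IsHermitian.cfc` in triple-product form; the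
  small private toolkit around it (multiplicativity, positivity, the support projection
  `CpsdFormulation.supp` and the support lemma `0 ⪯ Y ⪯ K ⇒ PY = Y`) is folklore finite-dimensional
  linear algebra.
* DEGENERATE SCENARIOS. PSVW tacitly take `m_A, m_B, o_A, o_B ≥ 1`; the typed statements hold for all
  values (with no settings on either side every `d ≥ 1` is a representation; a setting with no
  outcome admits no POVM and, consistently, `𝒜(p) = ∅`). `𝒟(p) ≥ 1` is automatic
  (`not_hasQuantumRep_zero`), matching "the smallest integer `d ≥ 1`".
* `cpsd-rank(R) ≤ d` is `HasCpsdFactorization R d` (PSVW Definition 1, `CompletelyPsdRank.lean`), so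
  "`min{cpsd-rank(R)}`" is typed as a least factorization size (`IsLeast`).

NOT typed here: PSVW Theorems 9, 12, 15 (Gram–Lorentz behaviours; §§4–5 — see
`GramLorentzBehaviors.lean`), SV Proposition 3.9 (closedness transfer `CS_+` closed ⇒ `𝒬` closed;
moot since `CS_+^n` is not closed for `n ≥ 10`, `CpsdConeNonClosure.lean`), the NPA comparison
(SV Thm 3.14) and the conic duality / game-value results of SV §§4–5.
-/

noncomputable section

open Matrix Finset
open scoped MatrixOrder ComplexOrder Kronecker

namespace Literature.Combinatorics.Optimization

/-! ### Toolkit: functional calculus of a Hermitian matrix, support projections, reduced operators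
(folklore finite-dimensional linear algebra; grouped in the sub-namespace `CpsdFormulation`) -/

namespace CpsdFormulation

variable {d : ℕ} {K : Matrix (Fin d) (Fin d) ℂ}

/-- The Hermitian functional calculus as a triple product. [folklore] -/
private theorem cfc_eq_mul (hK : K.IsHermitian) (f : ℝ → ℝ) :
    hK.cfc f = (hK.eigenvectorUnitary : Matrix (Fin d) (Fin d) ℂ) *
      diagonal (fun i => ((f (hK.eigenvalues i) : ℝ) : ℂ)) *
        star (hK.eigenvectorUnitary : Matrix (Fin d) (Fin d) ℂ) := by
  rw [Matrix.IsHermitian.cfc, Unitary.conjStarAlgAut_apply]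
  rfl

/-- Multiplicativity of the functional calculus. [folklore] -/
private theorem cfc_mul_cfc (hK : K.IsHermitian) (f g : ℝ → ℝ) :
    hK.cfc f * hK.cfc g = hK.cfc (f * g) := by
  simp only [Matrix.IsHermitian.cfc, ← map_mul, diagonal_mul_diagonal, Function.comp_apply]
  rfl

/-- The functional calculus only sees the values on the eigenvalues. [folklore] -/
private theorem cfc_congr (hK : K.IsHermitian) {f g : ℝ → ℝ}
    (h : ∀ i, f (hK.eigenvalues i) = g (hK.eigenvalues i)) : hK.cfc f = hK.cfc g := by
  simp only [Matrix.IsHermitian.cfc, Function.comp_def, h]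

/-- `cfc id = K` (the spectral theorem). [folklore] -/
private theorem cfc_id (hK : K.IsHermitian) : hK.cfc (fun x => x) = K := by
  conv_rhs => rw [hK.spectral_theorem]
  simp only [Matrix.IsHermitian.cfc, Function.comp_def]

/-- `cfc 1 = 1`. [folklore] -/
private theorem cfc_one (hK : K.IsHermitian) : hK.cfc (fun _ => 1) = 1 := by
  simp only [Matrix.IsHermitian.cfc, Function.comp_def, RCLike.ofReal_one]
  rw [diagonal_one, map_one]

/-- `cfc 0 = 0`. [folklore] -/
private theorem cfc_zero (hK : K.IsHermitian) : hK.cfc (fun _ => 0) = 0 := by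
  simp only [Matrix.IsHermitian.cfc, Function.comp_def, RCLike.ofReal_zero]
  rw [diagonal_zero, map_zero]

/-- The functional calculus of a real function is Hermitian. [folklore] -/
private theorem cfc_isHermitian (hK : K.IsHermitian) (f : ℝ → ℝ) : (hK.cfc f).IsHermitian := by
  rw [cfc_eq_mul, star_eq_conjTranspose]
  refine isHermitian_mul_mul_conjTranspose _ ?_
  rw [Matrix.IsHermitian, diagonal_conjTranspose]
  congr 1
  funext i
  simp

/-- The functional calculus of a function nonnegative on the spectrum is psd. [folklore] -/
private theorem cfc_posSemidef (hK : K.IsHermitian) {f : ℝ → ℝ} (hf : ∀ i, 0 ≤ f (hK.eigenvalues i)) :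
    (hK.cfc f).PosSemidef := by
  rw [cfc_eq_mul, star_eq_conjTranspose]
  refine PosSemidef.mul_mul_conjTranspose_same ?_ _
  exact posSemidef_diagonal_iff.mpr fun i => Complex.zero_le_real.mpr (hf i)

/-- `Tr(f(K)) = Σ_i f(λ_i)`. [folklore] -/
private theorem trace_cfc (hK : K.IsHermitian) (f : ℝ → ℝ) :
    (hK.cfc f).trace = ∑ i, ((f (hK.eigenvalues i) : ℝ) : ℂ) := by
  rw [cfc_eq_mul, trace_mul_cycle, Unitary.coe_star_mul_self, Matrix.one_mul, trace_diagonal]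

/-! #### Support projections and pseudo-inverse square roots of a psd matrix -/

/-- Indicator of the positive half-line (support function). [folklore] -/
def indPos (x : ℝ) : ℝ := if 0 < x then 1 else 0

/-- Pseudo-inverse square root function `x ↦ x^{-1/2}` on `x > 0`, `0` elsewhere. [folklore] -/
def invSqrt (x : ℝ) : ℝ := if 0 < x then (Real.sqrt x)⁻¹ else 0

/-- Fourth root `x ↦ x^{1/4}`. [folklore] -/
def root4 (x : ℝ) : ℝ := Real.sqrt (Real.sqrt x)

/-- Pseudo-inverse fourth root `x ↦ x^{-1/4}` on `x > 0`, `0` elsewhere. [folklore] -/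
def invRoot4 (x : ℝ) : ℝ := if 0 < x then (Real.sqrt (Real.sqrt x))⁻¹ else 0

/-- `1[x>0] ≥ 0`. [folklore] -/
private theorem indPos_nonneg (x : ℝ) : 0 ≤ indPos x := by
  unfold indPos; split_ifs <;> norm_num

/-- `1 − 1[x>0] ≥ 0`. [folklore] -/
private theorem one_sub_indPos_nonneg (x : ℝ) : 0 ≤ 1 - indPos x := by
  unfold indPos; split_ifs <;> norm_num

/-- `x^{-1/2} ≥ 0` (pseudo-inverse). [folklore] -/
private theorem invSqrt_nonneg (x : ℝ) : 0 ≤ invSqrt x := by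
  unfold invSqrt; split_ifs <;> [exact inv_nonneg.mpr (Real.sqrt_nonneg _); exact le_rfl]

/-- `x^{1/4} ≥ 0`. [folklore] -/
private theorem root4_nonneg (x : ℝ) : 0 ≤ root4 x := Real.sqrt_nonneg _

/-- `x^{-1/4} ≥ 0` (pseudo-inverse). [folklore] -/
private theorem invRoot4_nonneg (x : ℝ) : 0 ≤ invRoot4 x := by
  unfold invRoot4; split_ifs <;> [exact inv_nonneg.mpr (Real.sqrt_nonneg _); exact le_rfl]

/-- `1[x>0] · x = x` for `x ≥ 0`. [folklore] -/
private theorem indPos_mul_self {x : ℝ} (hx : 0 ≤ x) : indPos x * x = x := by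
  unfold indPos; split_ifs with h
  · exact one_mul x
  · have : x = 0 := le_antisymm (not_lt.mp h) hx
    rw [this, mul_zero]

/-- `(1 − 1[x>0]) · x = 0` for `x ≥ 0`. [folklore] -/
private theorem one_sub_indPos_mul_self {x : ℝ} (hx : 0 ≤ x) : (1 - indPos x) * x = 0 := by
  rw [sub_mul, one_mul, indPos_mul_self hx, sub_self]

/-- `(1 − 1[x>0]) · √x = 0` for `x ≥ 0`. [folklore] -/
private theorem one_sub_indPos_mul_sqrt {x : ℝ} (hx : 0 ≤ x) : (1 - indPos x) * Real.sqrt x = 0 := by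
  unfold indPos; split_ifs with h
  · simp
  · have : x = 0 := le_antisymm (not_lt.mp h) hx
    rw [this, Real.sqrt_zero, mul_zero]

/-- `√x · √x = x` for `x ≥ 0`. [folklore] -/
private theorem sqrt_mul_sqrt {x : ℝ} (hx : 0 ≤ x) : Real.sqrt x * Real.sqrt x = x := Real.mul_self_sqrt hx

/-- `x · x^{-1/2} = √x` for `x ≥ 0`. [folklore] -/
private theorem self_mul_invSqrt {x : ℝ} (hx : 0 ≤ x) : x * invSqrt x = Real.sqrt x := by
  unfold invSqrt; split_ifs with h
  · have hs : Real.sqrt x ≠ 0 := (Real.sqrt_pos.mpr h).ne'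
    calc x * (Real.sqrt x)⁻¹ = Real.sqrt x * Real.sqrt x * (Real.sqrt x)⁻¹ := by
          rw [Real.mul_self_sqrt hx]
      _ = Real.sqrt x := by field_simp
  · have : x = 0 := le_antisymm (not_lt.mp h) hx
    simp [this]

/-- `√x · x^{-1/2} = 1[x>0]`. [folklore] -/
private theorem sqrt_mul_invSqrt (x : ℝ) : Real.sqrt x * invSqrt x = indPos x := by
  unfold invSqrt indPos; split_ifs with h
  · exact mul_inv_cancel₀ (Real.sqrt_pos.mpr h).ne'
  · exact mul_zero _

/-- `x^{-1/2} · x · x^{-1/2} = 1[x>0]` for `x ≥ 0`. [folklore] -/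
private theorem invSqrt_mul_self_mul_invSqrt {x : ℝ} (hx : 0 ≤ x) :
    invSqrt x * x * invSqrt x = indPos x := by
  rw [mul_comm (invSqrt x) x, self_mul_invSqrt hx, sqrt_mul_invSqrt]

/-- `x^{1/4} · x^{1/4} = √x`. [folklore] -/
private theorem root4_mul_root4 (x : ℝ) : root4 x * root4 x = Real.sqrt x :=
  Real.mul_self_sqrt (Real.sqrt_nonneg x)

/-- `x^{1/4} · x^{-1/4} = 1[x>0]`. [folklore] -/
private theorem root4_mul_invRoot4 (x : ℝ) : root4 x * invRoot4 x = indPos x := by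
  unfold root4 invRoot4 indPos; split_ifs with h
  · exact mul_inv_cancel₀ (Real.sqrt_pos.mpr (Real.sqrt_pos.mpr h)).ne'
  · exact mul_zero _

/-- `x^{-1/4} · x · x^{-1/4} = √x` for `x ≥ 0`. [folklore] -/
private theorem invRoot4_mul_self_mul_invRoot4 {x : ℝ} (hx : 0 ≤ x) :
    invRoot4 x * x * invRoot4 x = Real.sqrt x := by
  unfold invRoot4; split_ifs with h
  · have ht : 0 < Real.sqrt (Real.sqrt x) := Real.sqrt_pos.mpr (Real.sqrt_pos.mpr h)
    set t := Real.sqrt (Real.sqrt x) with htdef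
    have hs : Real.sqrt x = t * t := (Real.mul_self_sqrt (Real.sqrt_nonneg x)).symm
    have hx' : x = (t * t) * (t * t) := by rw [← hs, Real.mul_self_sqrt hx]
    rw [hs, hx']
    field_simp
  · have : x = 0 := le_antisymm (not_lt.mp h) hx
    simp [this]

variable (hK : K.PosSemidef)

/-- Support projection `P = 1[K>0]`. [folklore] -/
abbrev supp : Matrix (Fin d) (Fin d) ℂ := hK.1.cfc indPos

/-- `P K = K` for the support projection `P` of `K ⪰ 0`. [folklore] -/
private theorem supp_mul_self : supp hK * K = K :=
  calc supp hK * K = hK.1.cfc indPos * hK.1.cfc (fun x => x) := by rw [cfc_id]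
    _ = hK.1.cfc (indPos * fun x => x) := cfc_mul_cfc _ _ _
    _ = hK.1.cfc (fun x => x) := cfc_congr hK.1 fun i => indPos_mul_self (hK.eigenvalues_nonneg i)
    _ = K := cfc_id hK.1

/-- `K P = K` for the support projection `P` of `K ⪰ 0`. [folklore] -/
private theorem self_mul_supp : K * supp hK = K :=
  calc K * supp hK = hK.1.cfc (fun x => x) * hK.1.cfc indPos := by rw [cfc_id]
    _ = hK.1.cfc ((fun x => x) * indPos) := cfc_mul_cfc _ _ _
    _ = hK.1.cfc (fun x => x) := cfc_congr hK.1 fun i => by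
        rw [Pi.mul_apply, mul_comm]; exact indPos_mul_self (hK.eigenvalues_nonneg i)
    _ = K := cfc_id hK.1

/-- The complementary projection `1 − P` is psd and kills `K`. [folklore] -/
private theorem one_sub_supp_eq : 1 - supp hK = hK.1.cfc (fun x => 1 - indPos x) := by
  rw [← cfc_one hK.1]
  simp only [Matrix.IsHermitian.cfc, ← map_sub, Function.comp_def]
  congr 1
  rw [diagonal_sub]
  congr 1
  funext i
  push_cast
  ring

/-- `1 − P ⪰ 0`. [folklore] -/
private theorem one_sub_supp_posSemidef : (1 - supp hK).PosSemidef := by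
  rw [one_sub_supp_eq]
  exact cfc_posSemidef hK.1 fun i => one_sub_indPos_nonneg _

/-- `(1 − P) K = 0`. [folklore] -/
private theorem one_sub_supp_mul_self : (1 - supp hK) * K = 0 := by
  rw [Matrix.sub_mul, Matrix.one_mul, supp_mul_self, sub_self]

/-- `K (1 − P) = 0`. [folklore] -/
private theorem self_mul_one_sub_supp : K * (1 - supp hK) = 0 := by
  rw [Matrix.mul_sub, Matrix.mul_one, self_mul_supp, sub_self]

/-- **Support lemma**: if `0 ⪯ Y ⪯ K` then `Y` lives on the support of `K`: `P Y = Y`.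
[folklore] -/
private theorem supp_mul_of_le {Y : Matrix (Fin d) (Fin d) ℂ} (hY : Y.PosSemidef)
    (hYK : (K - Y).PosSemidef) : supp hK * Y = Y := by
  set Q : Matrix (Fin d) (Fin d) ℂ := 1 - supp hK with hQ
  have hQh : Q.IsHermitian := by
    rw [hQ, one_sub_supp_eq]
    exact cfc_isHermitian _ _
  -- `Q Y Q = 0`
  have h1 : (Q * Y * Qᴴ).PosSemidef := hY.mul_mul_conjTranspose_same Q
  have h2 : (Q * (K - Y) * Qᴴ).PosSemidef := hYK.mul_mul_conjTranspose_same Q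
  have hQK : Q * K = 0 := one_sub_supp_mul_self hK
  have h3 : Q * (K - Y) * Qᴴ = -(Q * Y * Qᴴ) := by
    rw [Matrix.mul_sub, hQK, zero_sub, Matrix.neg_mul]
  rw [h3] at h2
  have htr : (Q * Y * Qᴴ).trace = 0 := by
    apply le_antisymm
    · have := h2.trace_nonneg
      rw [trace_neg] at this
      exact neg_nonneg.mp this
    · exact h1.trace_nonneg
  have hzero : Q * Y * Qᴴ = 0 := h1.trace_eq_zero_iff.mp htr
  -- `Y = Cᴴ C`, so `C Qᴴ = 0`
  obtain ⟨C, hC⟩ := CStarAlgebra.nonneg_iff_eq_star_mul_self.mp hY.nonneg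
  rw [star_eq_conjTranspose] at hC
  have hCQ : C * Qᴴ = 0 := by
    rw [← trace_conjTranspose_mul_self_eq_zero_iff, conjTranspose_mul, conjTranspose_conjTranspose]
    have : Q * Cᴴ * (C * Qᴴ) = Q * Y * Qᴴ := by rw [hC]; simp only [Matrix.mul_assoc]
    rw [this, hzero, trace_zero]
  have hYQ : Y * Q = 0 := by
    rw [hC, Matrix.mul_assoc, ← hQh.eq, hCQ, Matrix.mul_zero]
  -- `Y (1 - P) = 0` ⇒ `Y = Y P` ⇒ `Y = P Y`
  have hYP : Y * supp hK = Y := by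
    have := hYQ
    rw [hQ, Matrix.mul_sub, Matrix.mul_one, sub_eq_zero] at this
    exact this.symm
  have hPh : (supp hK).IsHermitian := cfc_isHermitian _ _
  calc supp hK * Y = (Yᴴ * (supp hK)ᴴ)ᴴ := by rw [← conjTranspose_mul, conjTranspose_conjTranspose]
    _ = Y := by rw [hY.1.eq, hPh.eq, hYP, hY.1.eq]

/-- **Support lemma**, right form: if `0 ⪯ Y ⪯ K` then `Y P = Y`. [folklore] -/
private theorem mul_supp_of_le {Y : Matrix (Fin d) (Fin d) ℂ} (hY : Y.PosSemidef)
    (hYK : (K - Y).PosSemidef) : Y * supp hK = Y := by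
  have hPh : (supp hK).IsHermitian := cfc_isHermitian _ _
  calc Y * supp hK = ((supp hK)ᴴ * Yᴴ)ᴴ := by rw [← conjTranspose_mul, conjTranspose_conjTranspose]
    _ = Y := by rw [hY.1.eq, hPh.eq, supp_mul_of_le hK hY hYK, hY.1.eq]

/-! #### The partial trace `N ↦ Tr_B((1 ⊗ N)ρ)` and trace identities -/

/-- `Φ_ρ(N) = Tr_B((I ⊗ N) ρ)ᵀ`-type reduced operator: `Φ_ρ(N)_{i'i} = Σ_{j,j'} N_{jj'} ρ_{(i',j'),(i,j)}`,
defined so that `Tr((M ⊗ N)ρ) = Tr(M Φ_ρ(N))`. [folklore] -/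
def ptrB (ρ : Matrix (Fin d × Fin d) (Fin d × Fin d) ℂ) (N : Matrix (Fin d) (Fin d) ℂ) :
    Matrix (Fin d) (Fin d) ℂ :=
  of fun i' i => ∑ j, ∑ j', N j j' * ρ (i', j') (i, j)

/-- `Tr((M ⊗ N)ρ) = Tr(M Φ_ρ(N))`. [folklore] -/
private theorem trace_kronecker_mul (M N : Matrix (Fin d) (Fin d) ℂ)
    (ρ : Matrix (Fin d × Fin d) (Fin d × Fin d) ℂ) :
    ((M ⊗ₖ N) * ρ).trace = (M * ptrB ρ N).trace := by
  simp only [Matrix.trace, Matrix.diag_apply, Matrix.mul_apply, Matrix.kroneckerMap_apply,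
    Fintype.sum_prod_type, ptrB, of_apply, Finset.mul_sum]
  refine Finset.sum_congr rfl fun i _ => ?_
  rw [Finset.sum_comm]
  refine Finset.sum_congr rfl fun i' _ => Finset.sum_congr rfl fun j _ =>
    Finset.sum_congr rfl fun j' _ => by ring

/-- `Φ_ρ` is additive. [folklore] -/
private theorem ptrB_add (ρ : Matrix (Fin d × Fin d) (Fin d × Fin d) ℂ) (N N' : Matrix (Fin d) (Fin d) ℂ) :
    ptrB ρ (N + N') = ptrB ρ N + ptrB ρ N' := by
  ext i' i
  simp only [ptrB, of_apply, Matrix.add_apply, add_mul, Finset.sum_add_distrib]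

/-- `Φ_ρ(0) = 0`. [folklore] -/
private theorem ptrB_zero (ρ : Matrix (Fin d × Fin d) (Fin d × Fin d) ℂ) : ptrB ρ 0 = 0 := by
  ext i' i
  simp [ptrB]

/-- `Φ_ρ` commutes with finite sums. [folklore] -/
private theorem ptrB_sum {ι : Type*} (ρ : Matrix (Fin d × Fin d) (Fin d × Fin d) ℂ) (s : Finset ι)
    (N : ι → Matrix (Fin d) (Fin d) ℂ) : ptrB ρ (∑ b ∈ s, N b) = ∑ b ∈ s, ptrB ρ (N b) := by
  classical
  induction s using Finset.induction_on with
  | empty => simp [ptrB_zero]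
  | insert b s hb ih => rw [Finset.sum_insert hb, Finset.sum_insert hb, ptrB_add, ih]

/-- `Φ_ρ(N − N') = Φ_ρ(N) − Φ_ρ(N')`. [folklore] -/
private theorem ptrB_sub (ρ : Matrix (Fin d × Fin d) (Fin d × Fin d) ℂ) (N N' : Matrix (Fin d) (Fin d) ℂ) :
    ptrB ρ (N - N') = ptrB ρ N - ptrB ρ N' := by
  ext i' i
  simp only [ptrB, of_apply, Matrix.sub_apply, sub_mul, Finset.sum_sub_distrib]

/-- `Tr Φ_ρ(1) = Tr ρ` (the reduced state has the same trace). [folklore] -/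
private theorem trace_ptrB_one (ρ : Matrix (Fin d × Fin d) (Fin d × Fin d) ℂ) :
    (ptrB ρ 1).trace = ρ.trace := by
  simp only [Matrix.trace, Matrix.diag_apply, ptrB, of_apply, Fintype.sum_prod_type, one_apply,
    ite_mul, one_mul, zero_mul, Finset.sum_ite_eq, Finset.mem_univ, if_true]

/-- `Tr(PQ) ≥ 0` for psd `P, Q` (any finite index type). [folklore] -/
private theorem trace_mul_nonneg_of_posSemidef' {n : Type*} [Fintype n] [DecidableEq n] {P Q : Matrix n n ℂ}
    (hP : P.PosSemidef) (hQ : Q.PosSemidef) : 0 ≤ (P * Q).trace := by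
  obtain ⟨C, hC⟩ := CStarAlgebra.nonneg_iff_eq_star_mul_self.mp hQ.nonneg
  rw [hC, star_eq_conjTranspose, ← Matrix.mul_assoc, trace_mul_cycle]
  exact (hP.mul_mul_conjTranspose_same C).trace_nonneg

/-- `x† A x = Tr(x x† A)`. [folklore] -/
private theorem star_dotProduct_mulVec_eq_trace {n : Type*} [Fintype n] (A : Matrix n n ℂ) (x : n → ℂ) :
    star x ⬝ᵥ (A *ᵥ x) = (vecMulVec x (star x) * A).trace := by
  simp only [dotProduct, mulVec, Matrix.trace, Matrix.diag_apply, Matrix.mul_apply, vecMulVec_apply,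
    Pi.star_apply, Finset.mul_sum]
  rw [Finset.sum_comm]
  exact Finset.sum_congr rfl fun i _ => Finset.sum_congr rfl fun i' _ => by ring

/-- `Φ_ρ(N)` is psd for psd `N`, `ρ`: `x† Φ(N) x = Tr((x x† ⊗ N) ρ) ≥ 0`. [folklore] -/
private theorem ptrB_posSemidef {ρ : Matrix (Fin d × Fin d) (Fin d × Fin d) ℂ} (hρ : ρ.PosSemidef)
    {N : Matrix (Fin d) (Fin d) ℂ} (hN : N.PosSemidef) : (ptrB ρ N).PosSemidef := by
  have hρh : ∀ u v, star (ρ v u) = ρ u v := fun u v => by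
    simpa [conjTranspose_apply] using congrFun (congrFun hρ.1 u) v
  have hNh : ∀ u v, star (N v u) = N u v := fun u v => by
    simpa [conjTranspose_apply] using congrFun (congrFun hN.1 u) v
  refine PosSemidef.of_dotProduct_mulVec_nonneg ?_ fun x => ?_
  · refine Matrix.IsHermitian.ext fun i i' => ?_
    simp only [ptrB, of_apply, star_sum, star_mul', hρh, hNh]
    rw [Finset.sum_comm]
  · rw [star_dotProduct_mulVec_eq_trace, ← trace_kronecker_mul]
    exact trace_mul_nonneg_of_posSemidef' ((posSemidef_vecMulVec_self_star x).kronecker hN) hρ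

/-- Positivity makes `Φ_ρ` monotone: `N ⪯ N'` gives `Φ(N) ⪯ Φ(N')`. [folklore] -/
private theorem ptrB_mono {ρ : Matrix (Fin d × Fin d) (Fin d × Fin d) ℂ} (hρ : ρ.PosSemidef)
    {N N' : Matrix (Fin d) (Fin d) ℂ} (h : (N' - N).PosSemidef) :
    (ptrB ρ N' - ptrB ρ N).PosSemidef := by
  rw [← ptrB_sub]
  exact ptrB_posSemidef hρ h

/-- For Hermitian `A, B`, `Tr(AB)` is real. [folklore] -/
private theorem star_trace_mul_of_isHermitian {A B : Matrix (Fin d) (Fin d) ℂ} (hA : A.IsHermitian)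
    (hB : B.IsHermitian) : star (A * B).trace = (A * B).trace := by
  rw [← trace_conjTranspose, conjTranspose_mul, hA.eq, hB.eq, trace_mul_comm]

/-- For Hermitian `A, B`, `Re Tr(AB) = Tr(AB)` (as a complex number). [folklore] -/
private theorem re_trace_mul_of_isHermitian {A B : Matrix (Fin d) (Fin d) ℂ} (hA : A.IsHermitian)
    (hB : B.IsHermitian) : (((A * B).trace.re : ℝ) : ℂ) = (A * B).trace :=
  Complex.conj_eq_iff_re.mp (star_trace_mul_of_isHermitian hA hB)

/-- The real Gram matrix `(Re Tr(P_i P_j))_{ij}` of a family of complex matrices. [folklore] -/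
def gramRe {ι : Type*} (P : ι → Matrix (Fin d) (Fin d) ℂ) : Matrix ι ι ℝ :=
  of fun i j => ((P i * P j).trace).re

/-- The entries of `gramRe` of a Hermitian family are the complex traces `Tr(P_i P_j)`. [folklore] -/
private theorem gramRe_coe {ι : Type*} {P : ι → Matrix (Fin d) (Fin d) ℂ} (hP : ∀ i, (P i).IsHermitian)
    (i j : ι) : ((gramRe P i j : ℝ) : ℂ) = (P i * P j).trace :=
  re_trace_mul_of_isHermitian (hP i) (hP j)

/-- The real Gram matrix of a psd family has that family as a `CS_+`-factorization (PSVW Def. 1).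
[cite: PrakashEtAl2017, Def. 1 (p04)] -/
theorem hasCpsdFactorization_gramRe {ι : Type*} {P : ι → Matrix (Fin d) (Fin d) ℂ}
    (hP : ∀ i, (P i).PosSemidef) : HasCpsdFactorization (gramRe P) d :=
  ⟨P, hP, fun i j => gramRe_coe (fun i => (hP i).1) i j⟩

/-- `gramRe` is symmetric. [folklore] -/
private theorem gramRe_transpose {ι : Type*} (P : ι → Matrix (Fin d) (Fin d) ℂ) : (gramRe P)ᵀ = gramRe P := by
  ext i j
  simp only [gramRe, transpose_apply, of_apply, trace_mul_comm (P j)]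

/-- `Tr((A ⊗ B) · vec(K) vec(K)†) = Tr(Kᴴ A K Bᵀ)`. [folklore] -/
private theorem trace_kronecker_mul_vecMulVec (A B K : Matrix (Fin d) (Fin d) ℂ) :
    ((A ⊗ₖ B) * vecMulVec (fun ij : Fin d × Fin d => K ij.1 ij.2)
        (star fun ij : Fin d × Fin d => K ij.1 ij.2)).trace = (Kᴴ * A * K * Bᵀ).trace := by
  simp only [Matrix.trace, Matrix.diag_apply, Matrix.mul_apply, Matrix.kroneckerMap_apply,
    Fintype.sum_prod_type, vecMulVec_apply, Pi.star_apply, conjTranspose_apply, transpose_apply,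
    Finset.sum_mul]
  -- LHS: Σ i Σ j Σ i' Σ j' A i i' * B j j' * (K i' j' * star (K i j))
  -- RHS: Σ j Σ j' Σ i' Σ i star (K i j) * A i i' * K i' j' * B j j'
  rw [Finset.sum_comm]
  refine Finset.sum_congr rfl fun j _ => ?_
  calc ∑ i, ∑ i', ∑ j', A i i' * B j j' * (K i' j' * star (K i j))
      = ∑ i, ∑ j', ∑ i', A i i' * B j j' * (K i' j' * star (K i j)) :=
        Finset.sum_congr rfl fun i _ => Finset.sum_comm
    _ = ∑ j', ∑ i, ∑ i', A i i' * B j j' * (K i' j' * star (K i j)) := Finset.sum_comm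
    _ = ∑ j', ∑ i', ∑ i, star (K i j) * A i i' * K i' j' * B j j' := by
        refine Finset.sum_congr rfl fun j' _ => ?_
        rw [Finset.sum_comm]
        exact Finset.sum_congr rfl fun i' _ => Finset.sum_congr rfl fun i _ => by ring

/-- `Tr(vec(K)vec(K)†) = Tr(K Kᴴ)`. [folklore] -/
private theorem trace_vecMulVec_eq (K : Matrix (Fin d) (Fin d) ℂ) :
    (vecMulVec (fun ij : Fin d × Fin d => K ij.1 ij.2) (star fun ij : Fin d × Fin d => K ij.1 ij.2)).trace
      = (K * Kᴴ).trace := by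
  rw [trace_vecMulVec]
  simp only [dotProduct, Fintype.sum_prod_type, Pi.star_apply, Matrix.trace, Matrix.diag_apply,
    Matrix.mul_apply, conjTranspose_apply]

/-- Cauchy–Schwarz equality for the trace inner product: `Tr A² = Tr AB = Tr B² = 1` forces `A = B`
(SV Lemma 3.6 (a)). [cite: SikoraVarvitsiotis2016, Lemma 3.6 (a) (p12)] -/
theorem eq_of_trace_eq_one' {A B : Matrix (Fin d) (Fin d) ℂ} (hA : A.IsHermitian)
    (hB : B.IsHermitian) (hAA : (A * A).trace = 1) (hAB : (A * B).trace = 1)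
    (hBB : (B * B).trace = 1) : A = B := by
  have hBA : (B * A).trace = 1 := by rw [trace_mul_comm, hAB]
  have h0 : ((A - B)ᴴ * (A - B)).trace = 0 := by
    rw [conjTranspose_sub, hA.eq, hB.eq, Matrix.sub_mul, Matrix.mul_sub, Matrix.mul_sub, trace_sub,
      trace_sub, trace_sub, hAA, hAB, hBA, hBB]
    ring
  exact sub_eq_zero.mp (trace_conjTranspose_mul_self_eq_zero_iff.mp h0)

end CpsdFormulation

open CpsdFormulation

/-! ### Bell scenarios: quantum and local behaviours, `𝒟(p)`, and the affine space `𝒜(p)` -/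

variable {mA mB oA oB : ℕ}

/-- The index set `([m_A] × [o_A]) ∪ ([m_B] × [o_B])` of the `n × n` matrices of Theorem 1,
`n = m_A o_A + m_B o_B`. [cite: PrakashEtAl2017, Thm. 1 (p05)] -/
abbrev BellIndex (mA mB oA oB : ℕ) : Type := (Fin mA × Fin oA) ⊕ (Fin mB × Fin oB)

/-- **A `d`-dimensional (quantum) representation of a behaviour** (PSVW p04–p05, verbatim): "the
state of the quantum system shared by Alice and Bob corresponds to a Hermitian psd matrix `ρ` acting
on `ℂ^d ⊗ ℂ^d`, with trace equal to `1`. The measurement process is described by two families of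
Hermitian psd operators `{M_{a|x}}_a` and `{N_{b|y}}_b`, each acting on `ℂ^d`, such that
`Σ_a M_{a|x} = Σ_b N_{b|y} = I_d` for all `x, y`"; "`p(ab|xy) = Tr((M_{a|x} ⊗ N_{b|y}) ρ)` for all
`a,b,x,y`"; "We say that `p ∈ 𝒬` admits a `d`-dimensional representation if there exists a quantum
representation … where `ρ` acts on `ℂ^d ⊗ ℂ^d` and `{M_{a|x}}_a` and `{N_{b|y}}_b` each act on `ℂ^d`."
A behaviour of an `(m_A,m_B,o_A,o_B)`-scenario is typed as `p x y a b = p(ab|xy)`; `ℂ^d ⊗ ℂ^d` is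
indexed by `Fin d × Fin d` and `M ⊗ N` is the Kronecker product.
[cite: PrakashEtAl2017, §1 (p04) and §1 "d-dimensional representation" (p05)] -/
def HasQuantumRep (p : Fin mA → Fin mB → Fin oA → Fin oB → ℝ) (d : ℕ) : Prop :=
  ∃ (ρ : Matrix (Fin d × Fin d) (Fin d × Fin d) ℂ) (M : Fin mA → Fin oA → Matrix (Fin d) (Fin d) ℂ)
    (N : Fin mB → Fin oB → Matrix (Fin d) (Fin d) ℂ),
    ρ.PosSemidef ∧ ρ.trace = 1 ∧ (∀ x a, (M x a).PosSemidef) ∧ (∀ x, ∑ a, M x a = 1) ∧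
      (∀ y b, (N y b).PosSemidef) ∧ (∀ y, ∑ b, N y b = 1) ∧
      ∀ x y a b, ((p x y a b : ℝ) : ℂ) = ((M x a ⊗ₖ N y b) * ρ).trace

/-- **The set `𝒬 = 𝒬(m_A,m_B,o_A,o_B)` of quantum behaviours** (p04): those admitting a quantum
representation of some (finite) dimension. [cite: PrakashEtAl2017, §1 (p04)] -/
def quantumBehaviors (mA mB oA oB : ℕ) : Set (Fin mA → Fin mB → Fin oA → Fin oB → ℝ) :=
  {p | ∃ d, HasQuantumRep p d}

/-- **`𝒟(p)`** (p05, verbatim): "the smallest integer `d ≥ 1` for which the quantum behavior `p`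
admits a `d`-dimensional representation" (`d = 0` is impossible: there is no trace-one state on
`ℂ^0`, `not_hasQuantumRep_zero`; for `p ∉ 𝒬` the value is the junk value `sInf ∅ = 0`).
[cite: PrakashEtAl2017, §1 (p05)] -/
def quantumDim (p : Fin mA → Fin mB → Fin oA → Fin oB → ℝ) : ℕ := sInf {d | HasQuantumRep p d}

/-- **Local (LHV) behaviours** (p04, verbatim): "`p` admits a LHV model (also referred to as being
local) if there exist `k_i ≥ 0`, `m_a^{x,i} ≥ 0`, `n_b^{y,i} ≥ 0` satisfying `Σ_i k_i = 1`, and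
`Σ_a m_a^{x,i} = Σ_b n_b^{y,i} = 1` for all `x,y,i`, such that `p(ab|xy) = Σ_i k_i m_a^{x,i} n_b^{y,i}`
for all `a,b,x,y`" (finitely many hidden values `i`). [cite: PrakashEtAl2017, §1 (p04)] -/
def localBehaviors (mA mB oA oB : ℕ) : Set (Fin mA → Fin mB → Fin oA → Fin oB → ℝ) :=
  {p | ∃ (r : ℕ) (k : Fin r → ℝ) (m : Fin r → Fin mA → Fin oA → ℝ) (n : Fin r → Fin mB → Fin oB → ℝ),
    (∀ i, 0 ≤ k i) ∧ ∑ i, k i = 1 ∧ (∀ i x a, 0 ≤ m i x a) ∧ (∀ i x, ∑ a, m i x a = 1) ∧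
      (∀ i y b, 0 ≤ n i y b) ∧ (∀ i y, ∑ b, n i y b = 1) ∧
      ∀ x y a b, p x y a b = ∑ i, k i * m i x a * n i y b}

/-- **The affine space `𝒜(p) ⊆ 𝒮^n`** of Theorem 1 (p05, verbatim): symmetric matrices `R` indexed
by `([m_A] × [o_A]) ∪ ([m_B] × [o_B])` with "`Σ_{a,a'} R_{xa,x'a'} = 1` for all `x,x'`;
`Σ_{a,b} R_{xa,yb} = 1` for all `x, y`; `Σ_{b,b'} R_{yb,y'b'} = 1` for all `y,y'`;
`R_{xa,yb} = p(ab|xy)` for all `a, b, x, y`" (conditions (1)–(4)).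
[cite: PrakashEtAl2017, Thm. 1, (1)–(4) and the definition of 𝒜(p) (p05)] -/
def behaviorAffine (p : Fin mA → Fin mB → Fin oA → Fin oB → ℝ) :
    Set (Matrix (BellIndex mA mB oA oB) (BellIndex mA mB oA oB) ℝ) :=
  {R | Rᵀ = R ∧ (∀ x x' : Fin mA, ∑ a, ∑ a', R (.inl (x, a)) (.inl (x', a')) = 1) ∧
    (∀ (x : Fin mA) (y : Fin mB), ∑ a, ∑ b, R (.inl (x, a)) (.inr (y, b)) = 1) ∧
    (∀ y y' : Fin mB, ∑ b, ∑ b', R (.inr (y, b)) (.inr (y', b')) = 1) ∧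
    ∀ x y a b, R (.inl (x, a)) (.inr (y, b)) = p x y a b}

/-- There is no `0`-dimensional representation (no trace-one state on `ℂ^0 ⊗ ℂ^0`), so `𝒟(p) ≥ 1`
automatically. [cite: PrakashEtAl2017, §1 (p05)] -/
theorem not_hasQuantumRep_zero (p : Fin mA → Fin mB → Fin oA → Fin oB → ℝ) : ¬ HasQuantumRep p 0 := by
  rintro ⟨ρ, -, -, -, hρ1, -⟩
  rw [Matrix.trace, Fintype.sum_empty] at hρ1
  exact zero_ne_one hρ1

/-- `𝒟(p)` is attained for `p ∈ 𝒬`. [cite: PrakashEtAl2017, §1 (p05)] -/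
theorem hasQuantumRep_quantumDim {p : Fin mA → Fin mB → Fin oA → Fin oB → ℝ}
    (hp : p ∈ quantumBehaviors mA mB oA oB) : HasQuantumRep p (quantumDim p) :=
  Nat.sInf_mem hp

/-- `𝒟(p) ≤ d` for every `d`-dimensional representation. [cite: PrakashEtAl2017, §1 (p05)] -/
theorem quantumDim_le {p : Fin mA → Fin mB → Fin oA → Fin oB → ℝ} {d : ℕ} (h : HasQuantumRep p d) :
    quantumDim p ≤ d :=
  Nat.sInf_le h

/-- `𝒟(p) ≥ 1` for `p ∈ 𝒬`. [cite: PrakashEtAl2017, §1 (p05)] -/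
theorem quantumDim_pos {p : Fin mA → Fin mB → Fin oA → Fin oB → ℝ}
    (hp : p ∈ quantumBehaviors mA mB oA oB) : 0 < quantumDim p := by
  rcases Nat.eq_zero_or_pos (quantumDim p) with h | h
  · exact absurd (h ▸ hasQuantumRep_quantumDim hp) (not_hasQuantumRep_zero p)
  · exact h

/-! ### From a quantum representation to a cpsd matrix in `𝒜(p)` of cpsd-rank `≤ d`
(SV Theorem 3.2 (i) ⇒ (ii), Lemma 3.6 (a), Theorem 3.7; mixed states via the reduced operators
`Tr_B((I ⊗ N)ρ)`, replacing the printed Schmidt-decomposition / purification step) -/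

/-- **Quantum ⇒ cpsd, dimension-exact** (SV Theorem 3.2 with Remark 3.3 and Lemma 3.6 (a); PSVW
Theorem 1 "only if" and the `≥` half of Theorem 2): a `d`-dimensional representation
`p(ab|xy) = Tr((M_{a|x} ⊗ N_{b|y})ρ)` yields `R ∈ CS_+ ∩ 𝒜(p)` with a `CS_+`-factorization of size
`d`, namely the Gram matrix of `X_{xa} = ρ_A^{1/4} M_{a|x} ρ_A^{1/4}` and
`Y_{yb} = ρ_A^{-1/4} Tr_B((I ⊗ N_{b|y})ρ) ρ_A^{-1/4}` (`ρ_A` the reduced state, pseudo-inverse roots;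
all row sums equal `K = ρ_A^{1/2}`, `Tr K² = 1`). For a pure state `ρ = ψψ*` in Schmidt form this
is the printed `X = K^{1/2} M K^{1/2}`, `Y = K^{1/2} Nᵀ K^{1/2}`; the reduced-operator form does
the mixed case without the purification remark of [SVW16].
[cite: SikoraVarvitsiotis2016, Thm. 3.2 + Rem. 3.3 (p11), Lemma 3.6 (a) (p12), Thm. 3.7 (p13);
PrakashEtAl2017, Thm. 1–2 (p05); SikoraVarvitsiotisWei2016, p03 (mixed states)] -/
theorem exists_cpsd_of_hasQuantumRep {p : Fin mA → Fin mB → Fin oA → Fin oB → ℝ} {d : ℕ}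
    (h : HasQuantumRep p d) : ∃ R ∈ behaviorAffine p, HasCpsdFactorization R d := by
  obtain ⟨ρ, M, N, hρ, hρ1, hM, hM1, hN, hN1, hp⟩ := h
  -- the reduced state `A = ρ_A` and its functional calculus
  set A : Matrix (Fin d) (Fin d) ℂ := ptrB ρ 1 with hAdef
  have hA : A.PosSemidef := ptrB_posSemidef hρ PosSemidef.one
  set S : Matrix (Fin d) (Fin d) ℂ := hA.1.cfc root4 with hSdef
  set S' : Matrix (Fin d) (Fin d) ℂ := hA.1.cfc invRoot4 with hS'def
  set Kh : Matrix (Fin d) (Fin d) ℂ := hA.1.cfc Real.sqrt with hKhdef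
  have hSh : S.IsHermitian := cfc_isHermitian _ _
  have hS'h : S'.IsHermitian := cfc_isHermitian _ _
  have hSS : S * S = Kh := by
    rw [hSdef, cfc_mul_cfc]; exact cfc_congr _ fun i => root4_mul_root4 _
  have hSS' : S * S' = supp hA := by
    rw [hSdef, hS'def, cfc_mul_cfc]; exact cfc_congr _ fun i => root4_mul_invRoot4 _
  have hS'S : S' * S = supp hA := by
    rw [hSdef, hS'def, cfc_mul_cfc]
    exact cfc_congr _ fun i => by rw [Pi.mul_apply, mul_comm]; exact root4_mul_invRoot4 _
  have hS'AS' : S' * A * S' = Kh := by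
    calc S' * A * S' = S' * hA.1.cfc (fun x => x) * S' := by rw [cfc_id]
      _ = Kh := by
        rw [hS'def, hKhdef, cfc_mul_cfc, cfc_mul_cfc]
        exact cfc_congr _ fun i => invRoot4_mul_self_mul_invRoot4 (hA.eigenvalues_nonneg i)
  have hKhKh : (Kh * Kh).trace = 1 := by
    have : Kh * Kh = A := by
      calc Kh * Kh = hA.1.cfc (fun x => x) := by
            rw [hKhdef, cfc_mul_cfc]; exact cfc_congr _ fun i => sqrt_mul_sqrt (hA.eigenvalues_nonneg i)
        _ = A := cfc_id _
    rw [this, hAdef, trace_ptrB_one, hρ1]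
  -- the two families of factors
  set X : Fin mA → Fin oA → Matrix (Fin d) (Fin d) ℂ := fun x a => S * M x a * S with hXdef
  set Y : Fin mB → Fin oB → Matrix (Fin d) (Fin d) ℂ := fun y b => S' * ptrB ρ (N y b) * S' with hYdef
  have hX : ∀ x a, (X x a).PosSemidef := fun x a => by
    have := (hM x a).mul_mul_conjTranspose_same S
    rwa [hSh.eq] at this
  have hY : ∀ y b, (Y y b).PosSemidef := fun y b => by
    have := (ptrB_posSemidef hρ (hN y b)).mul_mul_conjTranspose_same S'
    rwa [hS'h.eq] at this
  have hXsum : ∀ x, ∑ a, X x a = Kh := fun x => by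
    rw [hXdef]
    simp only [← Finset.sum_mul, ← Finset.mul_sum, hM1, Matrix.mul_one, hSS]
  have hYsum : ∀ y, ∑ b, Y y b = Kh := fun y => by
    rw [hYdef]
    simp only [← Finset.sum_mul, ← Finset.mul_sum, ← ptrB_sum, hN1]
    exact hS'AS'
  -- `Tr_B((I ⊗ N_{yb})ρ)` lives on the support of `ρ_A`
  have hsuppN : ∀ y b, supp hA * ptrB ρ (N y b) = ptrB ρ (N y b) ∧
      ptrB ρ (N y b) * supp hA = ptrB ρ (N y b) := by
    intro y b
    have h1N : (1 - N y b).PosSemidef := by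
      rw [← hN1 y, ← Finset.add_sum_erase _ _ (Finset.mem_univ b), add_sub_cancel_left]
      exact posSemidef_sum _ fun b' _ => hN y b'
    have hle : (A - ptrB ρ (N y b)).PosSemidef := by rw [hAdef]; exact ptrB_mono hρ h1N
    exact ⟨supp_mul_of_le hA (ptrB_posSemidef hρ (hN y b)) hle,
      mul_supp_of_le hA (ptrB_posSemidef hρ (hN y b)) hle⟩
  have hXY : ∀ x y a b, (X x a * Y y b).trace = ((M x a ⊗ₖ N y b) * ρ).trace := by
    intro x y a b
    obtain ⟨h1, h2⟩ := hsuppN y b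
    rw [trace_kronecker_mul, hXdef, hYdef]
    dsimp only
    have e1 : S * M x a * S * (S' * ptrB ρ (N y b) * S') =
        S * (M x a * (S * S') * ptrB ρ (N y b)) * S' := by simp only [Matrix.mul_assoc]
    rw [e1, trace_mul_cycle, hS'S, hSS']
    have e2 : supp hA * (M x a * supp hA * ptrB ρ (N y b)) =
        supp hA * M x a * (supp hA * ptrB ρ (N y b)) := by simp only [Matrix.mul_assoc]
    rw [e2, h1, trace_mul_cycle, h2, trace_mul_comm]
  -- the Gram matrix
  set F : BellIndex mA mB oA oB → Matrix (Fin d) (Fin d) ℂ :=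
    Sum.elim (fun xa => X xa.1 xa.2) (fun yb => Y yb.1 yb.2) with hFdef
  have hF : ∀ i, (F i).PosSemidef := by
    rintro (⟨x, a⟩ | ⟨y, b⟩)
    · exact hX x a
    · exact hY y b
  have hFh : ∀ i, (F i).IsHermitian := fun i => (hF i).1
  refine ⟨gramRe F, ⟨gramRe_transpose F, fun x x' => ?_, fun x y => ?_, fun y y' => ?_,
    fun x y a b => ?_⟩, hasCpsdFactorization_gramRe hF⟩
  · have hc : (((∑ a, ∑ a', gramRe F (.inl (x, a)) (.inl (x', a')) : ℝ) : ℂ)) = 1 := by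
      push_cast
      simp only [gramRe_coe hFh]
      calc ∑ a, ∑ a', (F (.inl (x, a)) * F (.inl (x', a'))).trace
          = ((∑ a, X x a) * (∑ a', X x' a')).trace := by
            rw [Finset.sum_mul]; simp only [Finset.mul_sum, trace_sum, hFdef, Sum.elim_inl]
        _ = 1 := by rw [hXsum, hXsum, hKhKh]
    exact_mod_cast hc
  · have hc : (((∑ a, ∑ b, gramRe F (.inl (x, a)) (.inr (y, b)) : ℝ) : ℂ)) = 1 := by
      push_cast
      simp only [gramRe_coe hFh]
      calc ∑ a, ∑ b, (F (.inl (x, a)) * F (.inr (y, b))).trace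
          = ((∑ a, X x a) * (∑ b, Y y b)).trace := by
            rw [Finset.sum_mul]; simp only [Finset.mul_sum, trace_sum, hFdef, Sum.elim_inl, Sum.elim_inr]
        _ = 1 := by rw [hXsum, hYsum, hKhKh]
    exact_mod_cast hc
  · have hc : (((∑ b, ∑ b', gramRe F (.inr (y, b)) (.inr (y', b')) : ℝ) : ℂ)) = 1 := by
      push_cast
      simp only [gramRe_coe hFh]
      calc ∑ b, ∑ b', (F (.inr (y, b)) * F (.inr (y', b'))).trace
          = ((∑ b, Y y b) * (∑ b', Y y' b')).trace := by
            rw [Finset.sum_mul]; simp only [Finset.mul_sum, trace_sum, hFdef, Sum.elim_inr]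
        _ = 1 := by rw [hYsum, hYsum, hKhKh]
    exact_mod_cast hc
  · have hc : ((gramRe F (.inl (x, a)) (.inr (y, b)) : ℝ) : ℂ) = p x y a b := by
      rw [gramRe_coe hFh, hFdef, Sum.elim_inl, Sum.elim_inr, hp]
      exact hXY x y a b
    exact_mod_cast hc

/-! ### Pure-state representations (GdLL §5; [SVW16] p03) -/

/-- **Realizability in local dimension `d` with a PURE state** (Gribling–de Laat–Laurent, LAA 513
(2017) §5, p16, verbatim): "there exist a unit vector `ψ ∈ ℂ^d ⊗ ℂ^d` and Hermitian positive
semidefinite `d × d` matrices `X_s^a` (`s ∈ S, a ∈ A`) and `Y_t^b` (`t ∈ T, b ∈ B`) satisfying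
`Σ_a X_s^a = Σ_b Y_t^b = I` for all `s, t` [and] `p(a,b|s,t) = ψ*(X_s^a ⊗ Y_t^b)ψ`" — PSVW's
`HasQuantumRep` with the density matrix specialised to `ψψ*`.
[cite: GriblingDelaatLaurent2017, §5 (p16), displays (14)–(15) in the arXiv numbering] -/
def HasPureQuantumRep (p : Fin mA → Fin mB → Fin oA → Fin oB → ℝ) (d : ℕ) : Prop :=
  ∃ (ψ : Fin d × Fin d → ℂ) (M : Fin mA → Fin oA → Matrix (Fin d) (Fin d) ℂ)
    (N : Fin mB → Fin oB → Matrix (Fin d) (Fin d) ℂ),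
    star ψ ⬝ᵥ ψ = 1 ∧ (∀ x a, (M x a).PosSemidef) ∧ (∀ x, ∑ a, M x a = 1) ∧
      (∀ y b, (N y b).PosSemidef) ∧ (∀ y, ∑ b, N y b = 1) ∧
      ∀ x y a b, ((p x y a b : ℝ) : ℂ) = star ψ ⬝ᵥ ((M x a ⊗ₖ N y b) *ᵥ ψ)

/-- A pure-state representation is a representation, with the density matrix `ρ = ψψ*`
(`Tr((M ⊗ N)ψψ*) = ψ*(M ⊗ N)ψ`). [cite: PrakashEtAl2017, §2.2 (p08, "rank 1 quantum states … called pure")] -/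
theorem HasPureQuantumRep.hasQuantumRep {p : Fin mA → Fin mB → Fin oA → Fin oB → ℝ} {d : ℕ}
    (h : HasPureQuantumRep p d) : HasQuantumRep p d := by
  obtain ⟨ψ, M, N, hψ, hM, hM1, hN, hN1, hp⟩ := h
  refine ⟨vecMulVec ψ (star ψ), M, N, posSemidef_vecMulVec_self_star ψ, ?_, hM, hM1, hN, hN1,
    fun x y a b => ?_⟩
  · rw [trace_vecMulVec, dotProduct_comm, hψ]
  · rw [hp, star_dotProduct_mulVec_eq_trace, trace_mul_comm]

/-! ### From a cpsd matrix in `𝒜(p)` with a size-`d` factorization to a `d`-dimensional representation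
(SV Theorem 3.2 (ii) ⇒ (i) with Remark 3.3; the printed "without loss of generality `K` has full
rank" is replaced by pseudo-inverse square roots plus a completion of the POVMs off the support) -/

/-- **SV Theorem 3.2, (ii) ⇒ (i), dimension-exact** (Remark 3.3: "if (5) has a feasible solution with
matrices … of size `d ≥ 1` then the correlation can be generated by a state in `ℂ^d ⊗ ℂ^d`"): psd
`d × d` matrices `X_{xa}, Y_{yb}` with all row sums equal to one `K ⪰ 0`, `Tr K² = 1`, and
`p(ab|xy) = Tr(X_{xa} Y_{yb})` give a `d`-dimensional representation: `ψ = vec(K)`,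
`M_{a|x} = K^{-1/2} X_{xa} K^{-1/2} (+ (I − P) for one `a`)`, `N_{b|y} = (K^{-1/2} Y_{yb} K^{-1/2} (+ (I − P)))ᵀ`,
`P` the support projection of `K`. [cite: SikoraVarvitsiotis2016, Thm. 3.2 (ii) ⇒ (i) and Rem. 3.3 (p11)] -/
theorem hasPureQuantumRep_of_factors {p : Fin mA → Fin mB → Fin oA → Fin oB → ℝ} {d : ℕ}
    (K : Matrix (Fin d) (Fin d) ℂ) (hK : K.PosSemidef) (hK1 : (K * K).trace = 1)
    (X : Fin mA → Fin oA → Matrix (Fin d) (Fin d) ℂ) (Y : Fin mB → Fin oB → Matrix (Fin d) (Fin d) ℂ)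
    (hX : ∀ x a, (X x a).PosSemidef) (hY : ∀ y b, (Y y b).PosSemidef) (hXs : ∀ x, ∑ a, X x a = K)
    (hYs : ∀ y, ∑ b, Y y b = K) (hp : ∀ x y a b, ((p x y a b : ℝ) : ℂ) = (X x a * Y y b).trace) :
    HasPureQuantumRep p d := by
  set S' : Matrix (Fin d) (Fin d) ℂ := hK.1.cfc invSqrt with hS'def
  set Kh : Matrix (Fin d) (Fin d) ℂ := hK.1.cfc Real.sqrt with hKhdef
  set Q : Matrix (Fin d) (Fin d) ℂ := 1 - supp hK with hQdef
  have hS'h : S'.IsHermitian := cfc_isHermitian _ _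
  have hQ : Q.PosSemidef := one_sub_supp_posSemidef hK
  have hKS' : K * S' = Kh := by
    calc K * S' = hK.1.cfc (fun x => x) * S' := by rw [cfc_id]
      _ = Kh := by
        rw [hS'def, hKhdef, cfc_mul_cfc]
        exact cfc_congr _ fun i => self_mul_invSqrt (hK.eigenvalues_nonneg i)
  have hS'K : S' * K = Kh := by
    calc S' * K = S' * hK.1.cfc (fun x => x) := by rw [cfc_id]
      _ = Kh := by
        rw [hS'def, hKhdef, cfc_mul_cfc]
        exact cfc_congr _ fun i => by
          rw [Pi.mul_apply, mul_comm]; exact self_mul_invSqrt (hK.eigenvalues_nonneg i)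
  have hS'KS' : S' * K * S' = supp hK := by
    rw [hS'K, hKhdef, hS'def, cfc_mul_cfc]; exact cfc_congr _ fun i => sqrt_mul_invSqrt _
  have hKhS' : Kh * S' = supp hK := by
    rw [hKhdef, hS'def, cfc_mul_cfc]; exact cfc_congr _ fun i => sqrt_mul_invSqrt _
  have hS'Kh : S' * Kh = supp hK := by
    rw [hKhdef, hS'def, cfc_mul_cfc]
    exact cfc_congr _ fun i => by rw [Pi.mul_apply, mul_comm]; exact sqrt_mul_invSqrt _
  have hKQ : K * Q = 0 := self_mul_one_sub_supp hK
  have hQKh : Q * Kh = 0 := by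
    rw [hQdef, one_sub_supp_eq, hKhdef, cfc_mul_cfc, ← cfc_zero hK.1]
    exact cfc_congr _ fun i => one_sub_indPos_mul_sqrt (hK.eigenvalues_nonneg i)
  -- supports
  have hXle : ∀ x a, (K - X x a).PosSemidef := fun x a => by
    rw [← hXs x, ← Finset.add_sum_erase _ _ (Finset.mem_univ a), add_sub_cancel_left]
    exact posSemidef_sum _ fun a' _ => hX x a'
  have hYle : ∀ y b, (K - Y y b).PosSemidef := fun y b => by
    rw [← hYs y, ← Finset.add_sum_erase _ _ (Finset.mem_univ b), add_sub_cancel_left]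
    exact posSemidef_sum _ fun b' _ => hY y b'
  -- outcome sets are nonempty whenever there is a setting
  have hoA : ∀ x : Fin mA, 0 < oA := fun x => by
    rcases Nat.eq_zero_or_pos oA with h0 | h0
    · exfalso
      subst h0
      have hK0 : K = 0 := by rw [← hXs x]; exact Fintype.sum_empty _
      rw [hK0, Matrix.mul_zero, trace_zero] at hK1
      exact zero_ne_one hK1
    · exact h0
  have hoB : ∀ y : Fin mB, 0 < oB := fun y => by
    rcases Nat.eq_zero_or_pos oB with h0 | h0
    · exfalso
      subst h0
      have hK0 : K = 0 := by rw [← hYs y]; exact Fintype.sum_empty _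
      rw [hK0, Matrix.mul_zero, trace_zero] at hK1
      exact zero_ne_one hK1
    · exact h0
  -- the measurements
  set Mt : Fin mA → Fin oA → Matrix (Fin d) (Fin d) ℂ :=
    fun x a => S' * X x a * S' + if (a : ℕ) = 0 then Q else 0 with hMtdef
  set Nt : Fin mB → Fin oB → Matrix (Fin d) (Fin d) ℂ :=
    fun y b => (S' * Y y b * S' + if (b : ℕ) = 0 then Q else 0)ᵀ with hNtdef
  have hpad : ∀ c : ℕ, (if c = 0 then Q else 0).PosSemidef := fun c => by
    split_ifs
    · exact hQ
    · exact PosSemidef.zero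
  have hMt : ∀ x a, (Mt x a).PosSemidef := fun x a => by
    have h1 := (hX x a).mul_mul_conjTranspose_same S'
    rw [hS'h.eq] at h1
    exact h1.add (hpad a)
  have hNt : ∀ y b, (Nt y b).PosSemidef := fun y b => by
    have h1 := (hY y b).mul_mul_conjTranspose_same S'
    rw [hS'h.eq] at h1
    exact (h1.add (hpad b)).transpose
  have hsumpad : ∀ {o : ℕ}, 0 < o → ∑ c : Fin o, (if (c : ℕ) = 0 then Q else 0) = Q := by
    intro o ho
    have : ∀ c : Fin o, ((c : ℕ) = 0) = (c = ⟨0, ho⟩) := fun c => by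
      simp only [Fin.ext_iff]
    simp only [this, Finset.sum_ite_eq', Finset.mem_univ, if_true]
  have hMt1 : ∀ x, ∑ a, Mt x a = 1 := fun x => by
    rw [hMtdef]
    dsimp only
    rw [Finset.sum_add_distrib, ← Finset.sum_mul, ← Finset.mul_sum, hXs, hS'KS', hsumpad (hoA x),
      hQdef, add_sub_cancel]
  have hNt1 : ∀ y, ∑ b, Nt y b = 1 := fun y => by
    rw [hNtdef]
    dsimp only
    rw [← transpose_sum, Finset.sum_add_distrib, ← Finset.sum_mul, ← Finset.mul_sum, hYs, hS'KS',
      hsumpad (hoB y), hQdef, add_sub_cancel, transpose_one]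
  -- the state `vec(K)` (unit vector; density matrix `vec(K) vec(K)†`)
  set ψ : Fin d × Fin d → ℂ := fun ij => K ij.1 ij.2 with hψdef
  refine ⟨ψ, Mt, Nt, ?_, hMt, hMt1, hNt, hNt1, fun x y a b => ?_⟩
  · rw [dotProduct_comm, ← trace_vecMulVec, hψdef, trace_vecMulVec_eq, ← hK.1.eq,
      conjTranspose_conjTranspose, hK.1.eq, hK1]
  · rw [star_dotProduct_mulVec_eq_trace, trace_mul_comm, hp, hψdef, trace_kronecker_mul_vecMulVec,
      hK.1.eq, hMtdef, hNtdef]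
    dsimp only
    rw [transpose_transpose]
    -- `K (S' X S' + c Q) K = Kh X Kh`
    have e1 : K * (S' * X x a * S' + if (a : ℕ) = 0 then Q else 0) * K = Kh * X x a * Kh := by
      rw [Matrix.mul_add, Matrix.add_mul]
      have : (K * (if (a : ℕ) = 0 then Q else 0)) * K = 0 := by
        split_ifs
        · rw [hKQ, Matrix.zero_mul]
        · rw [Matrix.mul_zero, Matrix.zero_mul]
      rw [this, add_zero]
      calc K * (S' * X x a * S') * K = (K * S') * X x a * (S' * K) := by simp only [Matrix.mul_assoc]
        _ = Kh * X x a * Kh := by rw [hKS', hS'K]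
    rw [e1, Matrix.mul_add, trace_add]
    have e2 : (Kh * X x a * Kh * (if (b : ℕ) = 0 then Q else 0)).trace = 0 := by
      split_ifs
      · rw [trace_mul_cycle, ← Matrix.mul_assoc, hQKh, Matrix.zero_mul, Matrix.zero_mul, trace_zero]
      · rw [Matrix.mul_zero, trace_zero]
    rw [e2, add_zero]
    have e3 : Kh * X x a * Kh * (S' * Y y b * S') = Kh * (X x a * (Kh * S') * Y y b) * S' := by
      simp only [Matrix.mul_assoc]
    rw [e3, trace_mul_cycle, hS'Kh, hKhS']
    have e4 : supp hK * (X x a * supp hK * Y y b) = supp hK * X x a * (supp hK * Y y b) := by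
      simp only [Matrix.mul_assoc]
    rw [e4, supp_mul_of_le hK (hX x a) (hXle x a), supp_mul_of_le hK (hY y b) (hYle y b)]

/-- **SV Theorem 3.2, (ii) ⇒ (i), dimension-exact**, density-matrix form (corollary of the pure
form `hasPureQuantumRep_of_factors`). [cite: SikoraVarvitsiotis2016, Thm. 3.2 (ii) ⇒ (i) and Rem. 3.3 (p11)] -/
theorem hasQuantumRep_of_factors {p : Fin mA → Fin mB → Fin oA → Fin oB → ℝ} {d : ℕ}
    (K : Matrix (Fin d) (Fin d) ℂ) (hK : K.PosSemidef) (hK1 : (K * K).trace = 1)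
    (X : Fin mA → Fin oA → Matrix (Fin d) (Fin d) ℂ) (Y : Fin mB → Fin oB → Matrix (Fin d) (Fin d) ℂ)
    (hX : ∀ x a, (X x a).PosSemidef) (hY : ∀ y b, (Y y b).PosSemidef) (hXs : ∀ x, ∑ a, X x a = K)
    (hYs : ∀ y, ∑ b, Y y b = K) (hp : ∀ x y a b, ((p x y a b : ℝ) : ℂ) = (X x a * Y y b).trace) :
    HasQuantumRep p d :=
  (hasPureQuantumRep_of_factors K hK hK1 X Y hX hY hXs hYs hp).hasQuantumRep

/-- The degenerate scenario with no measurement settings on either side, pure form: `ψ = e_0 ⊗ e_0`.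
[cite: GriblingDelaatLaurent2017, §5 (p16)] -/
theorem hasPureQuantumRep_of_isEmpty {p : Fin mA → Fin mB → Fin oA → Fin oB → ℝ} {d : ℕ}
    (hd : 0 < d) (hA : IsEmpty (Fin mA)) (hB : IsEmpty (Fin mB)) : HasPureQuantumRep p d := by
  refine ⟨Pi.single (⟨0, hd⟩, ⟨0, hd⟩) 1, fun x => isEmptyElim x, fun y => isEmptyElim y, ?_,
    fun x => isEmptyElim x, fun x => isEmptyElim x, fun y => isEmptyElim y, fun y => isEmptyElim y,
    fun x => isEmptyElim x⟩
  simp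

/-- The degenerate scenario with no measurement settings on either side: every `d ≥ 1` works.
[cite: PrakashEtAl2017, §1 (p05)] -/
theorem hasQuantumRep_of_isEmpty {p : Fin mA → Fin mB → Fin oA → Fin oB → ℝ} {d : ℕ} (hd : 0 < d)
    (hA : IsEmpty (Fin mA)) (hB : IsEmpty (Fin mB)) : HasQuantumRep p d :=
  (hasPureQuantumRep_of_isEmpty hd hA hB).hasQuantumRep

/-- From `R ∈ CS_+ ∩ 𝒜(p)` with a size-`d` factorization (`d ≥ 1`) to a PURE `d`-dimensional
representation: Lemma 3.6 (a) makes all row sums of the factors equal to one `K`, then SV Theorem 3.2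
(ii) ⇒ (i) (`hasPureQuantumRep_of_factors`); degenerate scenarios handled separately.
[cite: SikoraVarvitsiotis2016, Lemma 3.6 (a) (p12), Thm. 3.2 + Rem. 3.3 (p11), Thm. 3.7 (p13)] -/
theorem hasPureQuantumRep_of_cpsd {p : Fin mA → Fin mB → Fin oA → Fin oB → ℝ} {d : ℕ} (hd : 0 < d)
    {R : Matrix (BellIndex mA mB oA oB) (BellIndex mA mB oA oB) ℝ} (hR : R ∈ behaviorAffine p)
    (hRd : HasCpsdFactorization R d) : HasPureQuantumRep p d := by
  obtain ⟨_, h1, h2, h3, h4⟩ := hR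
  obtain ⟨F, hF, hRF⟩ := hRd
  set X : Fin mA → Fin oA → Matrix (Fin d) (Fin d) ℂ := fun x a => F (.inl (x, a)) with hXdef
  set Y : Fin mB → Fin oB → Matrix (Fin d) (Fin d) ℂ := fun y b => F (.inr (y, b)) with hYdef
  have hX : ∀ x a, (X x a).PosSemidef := fun x a => hF _
  have hY : ∀ y b, (Y y b).PosSemidef := fun y b => hF _
  have hSh : ∀ x, (∑ a, X x a).IsHermitian := fun x => (posSemidef_sum _ fun a _ => hX x a).1
  have hTh : ∀ y, (∑ b, Y y b).IsHermitian := fun y => (posSemidef_sum _ fun b _ => hY y b).1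
  -- the constraints in complex form
  have c1 : ∀ x x', ((∑ a, X x a) * ∑ a', X x' a').trace = 1 := fun x x' => by
    rw [Finset.sum_mul]
    simp only [Finset.mul_sum, trace_sum, hXdef, ← hRF]
    exact_mod_cast h1 x x'
  have c2 : ∀ x y, ((∑ a, X x a) * ∑ b, Y y b).trace = 1 := fun x y => by
    rw [Finset.sum_mul]
    simp only [Finset.mul_sum, trace_sum, hXdef, hYdef, ← hRF]
    exact_mod_cast h2 x y
  have c3 : ∀ y y', ((∑ b, Y y b) * ∑ b', Y y' b').trace = 1 := fun y y' => by
    rw [Finset.sum_mul]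
    simp only [Finset.mul_sum, trace_sum, hYdef, ← hRF]
    exact_mod_cast h3 y y'
  have hp : ∀ x y a b, ((p x y a b : ℝ) : ℂ) = (X x a * Y y b).trace := fun x y a b => by
    rw [← h4, hRF]
  by_cases hmA : Nonempty (Fin mA)
  · obtain ⟨x₀⟩ := hmA
    set K := ∑ a, X x₀ a with hKdef
    have hK : K.PosSemidef := posSemidef_sum _ fun a _ => hX x₀ a
    have hXs : ∀ x, ∑ a, X x a = K := fun x =>
      eq_of_trace_eq_one' (hSh x) (hSh x₀) (c1 x x) (c1 x x₀) (c1 x₀ x₀)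
    have hYs : ∀ y, ∑ b, Y y b = K := fun y =>
      eq_of_trace_eq_one' (hTh y) (hSh x₀) (c3 y y) (by rw [trace_mul_comm]; exact c2 x₀ y)
        (c1 x₀ x₀)
    exact hasPureQuantumRep_of_factors K hK (c1 x₀ x₀) X Y hX hY hXs hYs hp
  · by_cases hmB : Nonempty (Fin mB)
    · obtain ⟨y₀⟩ := hmB
      set K := ∑ b, Y y₀ b with hKdef
      have hK : K.PosSemidef := posSemidef_sum _ fun b _ => hY y₀ b
      have hXs : ∀ x, ∑ a, X x a = K := fun x => (hmA ⟨x⟩).elim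
      have hYs : ∀ y, ∑ b, Y y b = K := fun y =>
        eq_of_trace_eq_one' (hTh y) (hTh y₀) (c3 y y) (c3 y y₀) (c3 y₀ y₀)
      exact hasPureQuantumRep_of_factors K hK (c3 y₀ y₀) X Y hX hY hXs hYs hp
    · exact hasPureQuantumRep_of_isEmpty hd (not_nonempty_iff.mp hmA) (not_nonempty_iff.mp hmB)

/-- **The dimension-exact dictionary** (SV Theorem 3.2 + Remark 3.3 + Lemma 3.6 (a), both
directions; [SVW16] p03): for `d ≥ 1`, `p` has a `d`-dimensional representation iff some
`R ∈ 𝒜(p)` has a `CS_+`-factorization of size `d`.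
[cite: SikoraVarvitsiotis2016, Thm. 3.2, Rem. 3.3 (p11), Lemma 3.6 (a) (p12);
SikoraVarvitsiotisWei2016, p03; PrakashEtAl2017, Thm. 2 (p05)] -/
theorem hasQuantumRep_iff {p : Fin mA → Fin mB → Fin oA → Fin oB → ℝ} {d : ℕ} (hd : 0 < d) :
    HasQuantumRep p d ↔ ∃ R ∈ behaviorAffine p, HasCpsdFactorization R d :=
  ⟨exists_cpsd_of_hasQuantumRep, fun ⟨_, hR, hRd⟩ => (hasPureQuantumRep_of_cpsd hd hR hRd).hasQuantumRep⟩

/-! ### PSVW Theorem 1 (quantum part) and Theorem 2 -/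

/-- **PSVW Theorem 1, quantum part** ([SV] Theorem 3.7, `𝒬 = Corr(CS_+)`): "The behavior `p` is
quantum … if and only if there exists a matrix `R ∈ CS_+^n` … such that (1)–(4)", i.e.
`p ∈ 𝒬 ↔ CS_+^n ∩ 𝒜(p) ≠ ∅`. [cite: PrakashEtAl2017, Thm. 1 (p05); SikoraVarvitsiotis2016, Thm. 3.7 (p13)] -/
theorem mem_quantumBehaviors_iff (p : Fin mA → Fin mB → Fin oA → Fin oB → ℝ) :
    p ∈ quantumBehaviors mA mB oA oB ↔ ∃ R ∈ behaviorAffine p, IsCpsd R := by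
  constructor
  · rintro ⟨d, hd⟩
    obtain ⟨R, hR, hRd⟩ := exists_cpsd_of_hasQuantumRep hd
    exact ⟨R, hR, d, hRd⟩
  · rintro ⟨R, hR, d, hRd⟩
    exact ⟨d + 1, (hasQuantumRep_iff d.succ_pos).mpr ⟨R, hR, hRd.mono d.le_succ⟩⟩

/-- **PSVW Theorem 2** ([SV, SVW15], p05, verbatim): "For any `p ∈ 𝒬` we have that
`𝒟(p) = min{cpsd-rank(R) : R ∈ CS_+^n ∩ 𝒜(p)}`": `𝒟(p)` is the least `d ≥ 1` such that some
`R ∈ 𝒜(p)` has a `CS_+`-factorization of size `d` (cpsd-rank `≤ d`, Definition 1).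
[cite: PrakashEtAl2017, Thm. 2 (p05); SikoraVarvitsiotis2016, Rem. 3.3 (p11);
SikoraVarvitsiotisWei2016, p03] -/
theorem isLeast_quantumDim {p : Fin mA → Fin mB → Fin oA → Fin oB → ℝ}
    (hp : p ∈ quantumBehaviors mA mB oA oB) :
    IsLeast {d | 0 < d ∧ ∃ R ∈ behaviorAffine p, HasCpsdFactorization R d} (quantumDim p) := by
  refine ⟨⟨quantumDim_pos hp, (hasQuantumRep_iff (quantumDim_pos hp)).mp
    (hasQuantumRep_quantumDim hp)⟩, fun d ⟨hd, hR⟩ => quantumDim_le ((hasQuantumRep_iff hd).mpr hR)⟩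

/-- **Theorem 2 in the inequality form used downstream** (p06 and p16, verbatim): "given a quantum
behavior `p ∈ 𝒬`, for any `R ∈ CS_+^n ∩ 𝒜(p)` we have that `cpsd-rank(R) ≥ 𝒟(p)`".
[cite: PrakashEtAl2017, Thm. 2 (p05), §1.2 (p06), §5 (p16)] -/
theorem quantumDim_le_of_hasCpsdFactorization {p : Fin mA → Fin mB → Fin oA → Fin oB → ℝ}
    {R : Matrix (BellIndex mA mB oA oB) (BellIndex mA mB oA oB) ℝ} {d : ℕ}
    (hR : R ∈ behaviorAffine p) (hRd : HasCpsdFactorization R d) (hd : 0 < d) : quantumDim p ≤ d :=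
  quantumDim_le ((hasQuantumRep_iff hd).mpr ⟨R, hR, hRd⟩)

/-- Conversely `𝒟(p)` is attained by a cpsd matrix: some `R ∈ 𝒜(p)` has a `CS_+`-factorization of
size `𝒟(p)`. [cite: PrakashEtAl2017, Thm. 2 (p05)] -/
theorem exists_hasCpsdFactorization_quantumDim {p : Fin mA → Fin mB → Fin oA → Fin oB → ℝ}
    (hp : p ∈ quantumBehaviors mA mB oA oB) :
    ∃ R ∈ behaviorAffine p, HasCpsdFactorization R (quantumDim p) :=
  exists_cpsd_of_hasQuantumRep (hasQuantumRep_quantumDim hp)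

/-- "Any quantum behavior is no-signaling, i.e., each party's local marginal distribution is
independent of the other party's choice of measurement" (PSVW p05; SV Theorem 3.8 / Prop. 3.11,
`𝒬 ⊆ Corr(DNN) ⊆ NS`): `Σ_b p(ab|xy) = Σ_b p(ab|xy')` and `Σ_a p(ab|xy) = Σ_a p(ab|x'y)`.
[cite: PrakashEtAl2017, §1 (p05); SikoraVarvitsiotis2016, Thm. 3.8 (p13)] -/
theorem noSignaling_of_mem_quantumBehaviors {p : Fin mA → Fin mB → Fin oA → Fin oB → ℝ}
    (hp : p ∈ quantumBehaviors mA mB oA oB) :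
    (∀ x y y' a, ∑ b, p x y a b = ∑ b, p x y' a b) ∧ (∀ x x' y b, ∑ a, p x y a b = ∑ a, p x' y a b) := by
  obtain ⟨d, ρ, M, N, -, -, -, hM1, -, hN1, hpq⟩ := hp
  refine ⟨fun x y y' a => ?_, fun x x' y b => ?_⟩
  · have e : ∀ y, ((∑ b, p x y a b : ℝ) : ℂ) = (M x a * ptrB ρ 1).trace := fun y => by
      push_cast
      simp only [hpq, trace_kronecker_mul, ← trace_sum, ← Finset.mul_sum, ← ptrB_sum, hN1]
    exact_mod_cast (e y).trans (e y').symm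
  · have e : ∀ x, ((∑ a, p x y a b : ℝ) : ℂ) = (ptrB ρ (N y b)).trace := fun x => by
      push_cast
      simp only [hpq, trace_kronecker_mul, ← trace_sum, ← Finset.sum_mul, hM1, Matrix.one_mul]
    exact_mod_cast (e x).trans (e x').symm

/-! ### PSVW Theorem 1, local part: `ℒ = Corr(CP)` (SV Theorems 3.5 and 3.7) -/

/-- `Σ_a Σ_b Σ_i f_i(a) g_i(b) = Σ_i (Σ_a f_i(a)) (Σ_b g_i(b))`. [folklore] -/
private theorem sum_sum_sum_mul_eq {α β ι : Type*} [Fintype α] [Fintype β] [Fintype ι] (f : ι → α → ℝ)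
    (g : ι → β → ℝ) : ∑ a, ∑ b, ∑ i, f i a * g i b = ∑ i, (∑ a, f i a) * (∑ b, g i b) :=
  calc ∑ a, ∑ b, ∑ i, f i a * g i b = ∑ a, ∑ i, ∑ b, f i a * g i b :=
      Finset.sum_congr rfl fun a _ => Finset.sum_comm
    _ = ∑ i, ∑ a, ∑ b, f i a * g i b := Finset.sum_comm
    _ = ∑ i, (∑ a, f i a) * (∑ b, g i b) :=
      Finset.sum_congr rfl fun i _ => by rw [Finset.sum_mul_sum]

/-- **SV Theorem 3.5 / PSVW Theorem 1, local "only if"**: a local model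
`p(ab|xy) = Σ_i k_i m_a^{x,i} n_b^{y,i}` gives the completely positive matrix
`R = Gram(√k_i m^{x,i}_a, √k_i n^{y,i}_b) ∈ CP ∩ 𝒜(p)` (the printed diagonal matrices
`X^s_a = Σ_i x^{s,i}_a e_ie_iᵀ`, `ψ = Σ √k_i e_i ⊗ e_i`).
[cite: SikoraVarvitsiotis2016, Thm. 3.5 (i) ⇒ (ii) (p12), Thm. 3.7 (p13); PrakashEtAl2017, Thm. 1 (p05)] -/
theorem exists_cp_of_mem_localBehaviors {p : Fin mA → Fin mB → Fin oA → Fin oB → ℝ}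
    (hp : p ∈ localBehaviors mA mB oA oB) : ∃ R ∈ behaviorAffine p, IsCp R := by
  obtain ⟨r, k, m, n, hk, hk1, hm, hm1, hn, hn1, hpk⟩ := hp
  set u : BellIndex mA mB oA oB → Fin r → ℝ :=
    Sum.elim (fun xa i => Real.sqrt (k i) * m i xa.1 xa.2)
      (fun yb i => Real.sqrt (k i) * n i yb.1 yb.2) with hudef
  have hkk : ∀ i, Real.sqrt (k i) * Real.sqrt (k i) = k i := fun i => Real.mul_self_sqrt (hk i)
  refine ⟨fun s t => ∑ i, u s i * u t i, ⟨?_, fun x x' => ?_, fun x y => ?_, fun y y' => ?_,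
    fun x y a b => ?_⟩, r, u, ?_, fun s t => rfl⟩
  · ext s t
    simp only [transpose_apply, mul_comm]
  · rw [hudef]
    simp only [Sum.elim_inl]
    rw [sum_sum_sum_mul_eq (fun i a => Real.sqrt (k i) * m i x a) (fun i a' => Real.sqrt (k i) * m i x' a')]
    simp only [← Finset.mul_sum, hm1, mul_one, hkk, hk1]
  · rw [hudef]
    simp only [Sum.elim_inl, Sum.elim_inr]
    rw [sum_sum_sum_mul_eq (fun i a => Real.sqrt (k i) * m i x a) (fun i b => Real.sqrt (k i) * n i y b)]
    simp only [← Finset.mul_sum, hm1, hn1, mul_one, hkk, hk1]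
  · rw [hudef]
    simp only [Sum.elim_inr]
    rw [sum_sum_sum_mul_eq (fun i b => Real.sqrt (k i) * n i y b) (fun i b' => Real.sqrt (k i) * n i y' b')]
    simp only [← Finset.mul_sum, hn1, mul_one, hkk, hk1]
  · rw [hpk, hudef]
    simp only [Sum.elim_inl, Sum.elim_inr]
    exact Finset.sum_congr rfl fun i _ => by
      calc Real.sqrt (k i) * m i x a * (Real.sqrt (k i) * n i y b)
          = Real.sqrt (k i) * Real.sqrt (k i) * m i x a * n i y b := by ring
        _ = _ := by rw [hkk]
  · rintro (⟨x, a⟩ | ⟨y, b⟩) i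
    · exact mul_nonneg (Real.sqrt_nonneg _) (hm i x a)
    · exact mul_nonneg (Real.sqrt_nonneg _) (hn i y b)

/-- Cauchy–Schwarz equality for real vectors: `⟨s,s⟩ = ⟨s,t⟩ = ⟨t,t⟩ = 1 ⇒ s = t` (SV Lemma 3.6 (a)).
[cite: SikoraVarvitsiotis2016, Lemma 3.6 (a) (p12)] -/
theorem eq_of_dot_eq_one {r : ℕ} {s t : Fin r → ℝ} (hss : ∑ i, s i * s i = 1)
    (hst : ∑ i, s i * t i = 1) (htt : ∑ i, t i * t i = 1) : s = t := by
  have h : ∑ i, (s i - t i) * (s i - t i) = 0 := by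
    have : ∀ i, (s i - t i) * (s i - t i) = s i * s i - 2 * (s i * t i) + t i * t i := fun i => by
      ring
    simp only [this, Finset.sum_add_distrib, Finset.sum_sub_distrib, ← Finset.mul_sum, hss, hst, htt]
    ring
  funext i
  have hi := (Finset.sum_eq_zero_iff_of_nonneg fun i _ => mul_self_nonneg (s i - t i)).mp h i
    (Finset.mem_univ i)
  exact sub_eq_zero.mp (mul_self_eq_zero.mp hi)

/-- **SV Theorem 3.5 / PSVW Theorem 1, local "if"**, dimension-free core: nonnegative vectors
`u_{xa}, v_{yb} ∈ ℝ^r_+` whose row sums all equal one `w` with `⟨w,w⟩ = 1` and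
`p(ab|xy) = ⟨u_{xa}, v_{yb}⟩` give the local model `k_i = w_i²`, `m^{x,i}_a = u_{xa,i}/w_i`,
`n^{y,i}_b = v_{yb,i}/w_i` (coordinates with `w_i = 0` carry no mass).
[cite: SikoraVarvitsiotis2016, Thm. 3.5 (ii) ⇒ (i) (p12)] -/
theorem mem_localBehaviors_of_factors {p : Fin mA → Fin mB → Fin oA → Fin oB → ℝ} {r : ℕ}
    (w : Fin r → ℝ) (hw0 : ∀ i, 0 ≤ w i) (hw : ∑ i, w i * w i = 1)
    (u : Fin mA → Fin oA → Fin r → ℝ) (v : Fin mB → Fin oB → Fin r → ℝ)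
    (hu : ∀ x a i, 0 ≤ u x a i) (hv : ∀ y b i, 0 ≤ v y b i) (hus : ∀ x i, ∑ a, u x a i = w i)
    (hvs : ∀ y i, ∑ b, v y b i = w i) (hp : ∀ x y a b, p x y a b = ∑ i, u x a i * v y b i) :
    p ∈ localBehaviors mA mB oA oB := by
  have hoA : ∀ x : Fin mA, 0 < oA := fun x => by
    rcases Nat.eq_zero_or_pos oA with h0 | h0
    · exfalso
      subst h0
      have hw00 : ∀ i, w i = 0 := fun i => by rw [← hus x i]; exact Fintype.sum_empty _
      simp [hw00] at hw
    · exact h0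
  have hoB : ∀ y : Fin mB, 0 < oB := fun y => by
    rcases Nat.eq_zero_or_pos oB with h0 | h0
    · exfalso
      subst h0
      have hw00 : ∀ i, w i = 0 := fun i => by rw [← hvs y i]; exact Fintype.sum_empty _
      simp [hw00] at hw
    · exact h0
  have hsumpad : ∀ {o : ℕ}, 0 < o → ∑ c : Fin o, (if (c : ℕ) = 0 then (1 : ℝ) else 0) = 1 := by
    intro o ho
    have : ∀ c : Fin o, ((c : ℕ) = 0) = (c = ⟨0, ho⟩) := fun c => by simp only [Fin.ext_iff]
    simp only [this, Finset.sum_ite_eq', Finset.mem_univ, if_true]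
  -- coordinates off the support of `w` carry no mass
  have hu0 : ∀ x a i, w i = 0 → u x a i = 0 := by
    intro x a i hi
    refine le_antisymm ?_ (hu x a i)
    calc u x a i ≤ ∑ a', u x a' i := Finset.single_le_sum (fun a' _ => hu x a' i) (Finset.mem_univ a)
      _ = 0 := by rw [hus x i, hi]
  have hv0 : ∀ y b i, w i = 0 → v y b i = 0 := by
    intro y b i hi
    refine le_antisymm ?_ (hv y b i)
    calc v y b i ≤ ∑ b', v y b' i := Finset.single_le_sum (fun b' _ => hv y b' i) (Finset.mem_univ b)
      _ = 0 := by rw [hvs y i, hi]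
  refine ⟨r, fun i => w i * w i,
    fun i x a => if w i = 0 then (if (a : ℕ) = 0 then 1 else 0) else u x a i / w i,
    fun i y b => if w i = 0 then (if (b : ℕ) = 0 then 1 else 0) else v y b i / w i,
    fun i => mul_self_nonneg _, hw, fun i x a => ?_, fun i x => ?_, fun i y b => ?_, fun i y => ?_,
    fun x y a b => ?_⟩
  · dsimp only
    split_ifs
    · exact zero_le_one
    · exact le_rfl
    · exact div_nonneg (hu x a i) (hw0 i)
  · dsimp only
    split_ifs with hi
    · exact hsumpad (hoA x)
    · rw [← Finset.sum_div, hus, div_self hi]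
  · dsimp only
    split_ifs
    · exact zero_le_one
    · exact le_rfl
    · exact div_nonneg (hv y b i) (hw0 i)
  · dsimp only
    split_ifs with hi
    · exact hsumpad (hoB y)
    · rw [← Finset.sum_div, hvs, div_self hi]
  · rw [hp]
    refine Finset.sum_congr rfl fun i _ => ?_
    dsimp only
    by_cases hi : w i = 0
    · rw [hu0 x a i hi, hi]
      simp
    · simp only [hi, if_false]
      field_simp

/-- **SV Theorem 3.5 / PSVW Theorem 1, local "if"**: `R ∈ CP ∩ 𝒜(p)` gives a local model (the row
sums of the nonnegative Gram vectors coincide by Lemma 3.6 (a)).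
[cite: SikoraVarvitsiotis2016, Thm. 3.5 (p12), Lemma 3.6 (a) (p12), Thm. 3.7 (p13);
PrakashEtAl2017, Thm. 1 (p05)] -/
theorem mem_localBehaviors_of_cp {p : Fin mA → Fin mB → Fin oA → Fin oB → ℝ}
    {R : Matrix (BellIndex mA mB oA oB) (BellIndex mA mB oA oB) ℝ} (hR : R ∈ behaviorAffine p)
    (hRcp : IsCp R) : p ∈ localBehaviors mA mB oA oB := by
  obtain ⟨_, h1, h2, h3, h4⟩ := hR
  obtain ⟨r, U, hU, hRU⟩ := hRcp
  set u : Fin mA → Fin oA → Fin r → ℝ := fun x a => U (.inl (x, a)) with hudef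
  set v : Fin mB → Fin oB → Fin r → ℝ := fun y b => U (.inr (y, b)) with hvdef
  set sx : Fin mA → Fin r → ℝ := fun x i => ∑ a, u x a i with hsxdef
  set ty : Fin mB → Fin r → ℝ := fun y i => ∑ b, v y b i with htydef
  have c1 : ∀ x x', ∑ i, sx x i * sx x' i = 1 := fun x x' => by
    rw [← h1 x x']
    simp only [hRU]
    exact (sum_sum_sum_mul_eq (fun i a => u x a i) (fun i a' => u x' a' i)).symm
  have c2 : ∀ x y, ∑ i, sx x i * ty y i = 1 := fun x y => by
    rw [← h2 x y]
    simp only [hRU]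
    exact (sum_sum_sum_mul_eq (fun i a => u x a i) (fun i b => v y b i)).symm
  have c3 : ∀ y y', ∑ i, ty y i * ty y' i = 1 := fun y y' => by
    rw [← h3 y y']
    simp only [hRU]
    exact (sum_sum_sum_mul_eq (fun i b => v y b i) (fun i b' => v y' b' i)).symm
  have hu : ∀ x a i, 0 ≤ u x a i := fun x a i => hU _ i
  have hv : ∀ y b i, 0 ≤ v y b i := fun y b i => hU _ i
  have hp : ∀ x y a b, p x y a b = ∑ i, u x a i * v y b i := fun x y a b => by rw [← h4, hRU]
  by_cases hmA : Nonempty (Fin mA)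
  · obtain ⟨x₀⟩ := hmA
    refine mem_localBehaviors_of_factors (sx x₀) (fun i => Finset.sum_nonneg fun a _ => hu x₀ a i)
      (c1 x₀ x₀) u v hu hv (fun x i => ?_) (fun y i => ?_) hp
    · exact congrFun (eq_of_dot_eq_one (c1 x x) (c1 x x₀) (c1 x₀ x₀)) i
    · have := eq_of_dot_eq_one (c3 y y) (by simpa only [mul_comm] using c2 x₀ y) (c1 x₀ x₀)
      exact congrFun this i
  · by_cases hmB : Nonempty (Fin mB)
    · obtain ⟨y₀⟩ := hmB
      refine mem_localBehaviors_of_factors (ty y₀) (fun i => Finset.sum_nonneg fun b _ => hv y₀ b i)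
        (c3 y₀ y₀) u v hu hv (fun x i => (hmA ⟨x⟩).elim) (fun y i => ?_) hp
      exact congrFun (eq_of_dot_eq_one (c3 y y) (c3 y y₀) (c3 y₀ y₀)) i
    · refine ⟨1, fun _ => 1, fun _ x => (hmA ⟨x⟩).elim, fun _ y => (hmB ⟨y⟩).elim,
        fun _ => zero_le_one, by simp, fun _ x => (hmA ⟨x⟩).elim, fun _ x => (hmA ⟨x⟩).elim,
        fun _ y => (hmB ⟨y⟩).elim, fun _ y => (hmB ⟨y⟩).elim, fun x => (hmA ⟨x⟩).elim⟩

/-- **PSVW Theorem 1, local part** ([SV] Theorems 3.5 and 3.7, `ℒ = Corr(CP)`): "`p` is … local if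
and only if there exists a matrix `R ∈ CP^n` … such that (1)–(4)".
[cite: PrakashEtAl2017, Thm. 1 (p05); SikoraVarvitsiotis2016, Thm. 3.5 (p12), Thm. 3.7 (p13)] -/
theorem mem_localBehaviors_iff (p : Fin mA → Fin mB → Fin oA → Fin oB → ℝ) :
    p ∈ localBehaviors mA mB oA oB ↔ ∃ R ∈ behaviorAffine p, IsCp R :=
  ⟨exists_cp_of_mem_localBehaviors, fun ⟨_, hR, hRcp⟩ => mem_localBehaviors_of_cp hR hRcp⟩

/-- "Clearly, `ℒ ⊆ 𝒬`" (PSVW p04), here through Theorem 1 and `CP ⊆ CS_+`.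
[cite: PrakashEtAl2017, §1 (p04)] -/
theorem localBehaviors_subset_quantumBehaviors :
    localBehaviors mA mB oA oB ⊆ quantumBehaviors mA mB oA oB := fun p hp => by
  obtain ⟨R, hR, hRcp⟩ := (mem_localBehaviors_iff p).mp hp
  exact (mem_quantumBehaviors_iff p).mpr ⟨R, hR, hRcp.isCpsd⟩

/-! ### PSVW Proposition 1 -/

/-- **PSVW Proposition 1 (i)** (p05, verbatim): "If `max{cpsd-rank(X) : X ∈ CS_+^n} < +∞` then
`max{𝒟(p) : p ∈ 𝒬} < +∞`" (`n = m_A o_A + m_B o_B`; a uniform factorization size `f` for all of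
`CS_+^n` bounds `𝒟` on `𝒬` by `f`, or by `1` if `f = 0`). [cite: PrakashEtAl2017, Prop. 1 (i) (p05)] -/
theorem quantumDim_bounded_of_cpsdRank_bounded
    (h : ∃ f : ℕ, ∀ X : Matrix (BellIndex mA mB oA oB) (BellIndex mA mB oA oB) ℝ,
      IsCpsd X → HasCpsdFactorization X f) :
    ∃ f : ℕ, ∀ p ∈ quantumBehaviors mA mB oA oB, quantumDim p ≤ f := by
  obtain ⟨f, hf⟩ := h
  refine ⟨f + 1, fun p hp => ?_⟩
  obtain ⟨R, hR, hRc⟩ := (mem_quantumBehaviors_iff p).mp hp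
  exact quantumDim_le_of_hasCpsdFactorization hR ((hf R hRc).mono f.le_succ) f.succ_pos

/-- **PSVW Proposition 1 (ii)** (p05, verbatim): "Say that for every `d ≥ 1` there exists `p_d ∈ 𝒬`
such that for any `R ∈ CS_+^n ∩ 𝒜(p_d)` we have `cpsd-rank(R) > d`. Then `max{𝒟(p) : p ∈ 𝒬} = +∞`."
[cite: PrakashEtAl2017, Prop. 1 (ii) (p05)] -/
theorem quantumDim_unbounded_of_cpsdRank_unbounded
    (h : ∀ d : ℕ, 0 < d → ∃ p ∈ quantumBehaviors mA mB oA oB,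
      ∀ R ∈ behaviorAffine p, IsCpsd R → ¬ HasCpsdFactorization R d) :
    ∀ d : ℕ, ∃ p ∈ quantumBehaviors mA mB oA oB, d < quantumDim p := by
  intro d
  obtain ⟨p, hp, hR⟩ := h (d + 1) d.succ_pos
  refine ⟨p, hp, ?_⟩
  by_contra hle
  obtain ⟨R, hRA, hRd⟩ := exists_hasCpsdFactorization_quantumDim hp
  exact hR R hRA ⟨_, hRd⟩ (hRd.mono (by omega))

/-! ### The three results as named statements (typed as printed; all PROVED above) -/

/-- **PSVW Theorem 1** ([SV]; p05, verbatim): "Consider a behavior `p = (p(ab|xy))` and set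
`n := m_A o_A + m_B o_B`. The behavior `p` is quantum (resp. local) if and only if there exists a
matrix `R ∈ CS_+^n` (resp. `CP^n`) indexed by `([m_A] × [o_A]) ∪ ([m_B] × [o_B])` such that
`Σ_{a,a'} R_{xa,x'a'} = 1` for all `x,x'`; `Σ_{a,b} R_{xa,yb} = 1` for all `x, y`;
`Σ_{b,b'} R_{yb,y'b'} = 1` for all `y,y'`; `R_{xa,yb} = p(ab|xy)` for all `a, b, x, y`."
PROVED: `PrakashEtAl2017_thm1_holds`. [cite: PrakashEtAl2017, Thm. 1 (p05); SikoraVarvitsiotis2016, Thm. 3.7 (p13)] -/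
def PrakashEtAl2017_thm1 : Prop :=
  ∀ (mA mB oA oB : ℕ) (p : Fin mA → Fin mB → Fin oA → Fin oB → ℝ),
    (p ∈ quantumBehaviors mA mB oA oB ↔ ∃ R ∈ behaviorAffine p, IsCpsd R) ∧
      (p ∈ localBehaviors mA mB oA oB ↔ ∃ R ∈ behaviorAffine p, IsCp R)

/-- Discharge of `PrakashEtAl2017_thm1`. [cite: PrakashEtAl2017, Thm. 1 (p05)] -/
theorem PrakashEtAl2017_thm1_holds : PrakashEtAl2017_thm1 := fun _ _ _ _ p =>
  ⟨mem_quantumBehaviors_iff p, mem_localBehaviors_iff p⟩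

/-- **PSVW Theorem 2** ([SV, SVW15]; p05, verbatim): "For any `p ∈ 𝒬` we have that
`𝒟(p) = min{cpsd-rank(R) : R ∈ CS_+^n ∩ 𝒜(p)}`" — typed: `𝒟(p)` is the least `d ≥ 1` for which
some `R ∈ 𝒜(p)` has a `CS_+`-factorization of size `d` (Definition 1: `cpsd-rank(R) ≤ d`).
PROVED: `PrakashEtAl2017_thm2_holds`. [cite: PrakashEtAl2017, Thm. 2 (p05);
SikoraVarvitsiotis2016, Thm. 3.2 + Rem. 3.3 (p11); SikoraVarvitsiotisWei2016, p03] -/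
def PrakashEtAl2017_thm2 : Prop :=
  ∀ (mA mB oA oB : ℕ) (p : Fin mA → Fin mB → Fin oA → Fin oB → ℝ),
    p ∈ quantumBehaviors mA mB oA oB →
      IsLeast {d | 0 < d ∧ ∃ R ∈ behaviorAffine p, HasCpsdFactorization R d} (quantumDim p)

/-- Discharge of `PrakashEtAl2017_thm2`. [cite: PrakashEtAl2017, Thm. 2 (p05)] -/
theorem PrakashEtAl2017_thm2_holds : PrakashEtAl2017_thm2 := fun _ _ _ _ _ hp =>
  isLeast_quantumDim hp

/-- **PSVW Proposition 1** (p05, verbatim): "Fix a `(m_A,m_B,o_A,o_B)`-scenario, set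
`n := m_A o_A + m_B o_B` and let `𝒬` be the corresponding set of quantum behaviors. We have that:
(i) If `max{cpsd-rank(X) : X ∈ CS_+^n} < +∞` then `max{𝒟(p) : p ∈ 𝒬} < +∞`; (ii) Say that for every
`d ≥ 1` there exists `p_d ∈ 𝒬` such that for any `R ∈ CS_+^n ∩ 𝒜(p_d)` we have `cpsd-rank(R_d) > d`.
Then `max{𝒟(p) : p ∈ 𝒬} = +∞`." PROVED: `PrakashEtAl2017_prop1_holds`.
[cite: PrakashEtAl2017, Prop. 1 (p05)] -/
def PrakashEtAl2017_prop1 : Prop :=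
  ∀ mA mB oA oB : ℕ,
    ((∃ f : ℕ, ∀ X : Matrix (BellIndex mA mB oA oB) (BellIndex mA mB oA oB) ℝ,
        IsCpsd X → HasCpsdFactorization X f) →
      ∃ f : ℕ, ∀ p ∈ quantumBehaviors mA mB oA oB, quantumDim p ≤ f) ∧
    ((∀ d : ℕ, 0 < d → ∃ p ∈ quantumBehaviors mA mB oA oB,
        ∀ R ∈ behaviorAffine p, IsCpsd R → ¬ HasCpsdFactorization R d) →
      ∀ d : ℕ, ∃ p ∈ quantumBehaviors mA mB oA oB, d < quantumDim p)

/-- Discharge of `PrakashEtAl2017_prop1`. [cite: PrakashEtAl2017, Prop. 1 (p05)] -/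
theorem PrakashEtAl2017_prop1_holds : PrakashEtAl2017_prop1 := fun _ _ _ _ =>
  ⟨quantumDim_bounded_of_cpsdRank_bounded, quantumDim_unbounded_of_cpsdRank_unbounded⟩


/-! ### SV Theorem 3.8 / Proposition 3.11: psd matrices in `𝒜(p)` force no-signaling (appended) -/

section NoSignaling

variable {mA mB oA oB : ℕ}

/-- Indicator vector of Alice's block `{x} × [o_A]`. [cite: SikoraVarvitsiotis2016, Lemma 3.6 (a) (p12)] -/
private def blockA (x : Fin mA) : BellIndex mA mB oA oB → ℝ :=
  Sum.elim (fun xa => if xa.1 = x then 1 else 0) (fun _ => 0)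

/-- Indicator vector of Bob's block `{y} × [o_B]`. [cite: SikoraVarvitsiotis2016, Lemma 3.6 (a) (p12)] -/
private def blockB (y : Fin mB) : BellIndex mA mB oA oB → ℝ :=
  Sum.elim (fun _ => 0) (fun yb => if yb.1 = y then 1 else 0)

/-- `(R e_{S_x})_i = Σ_a R_{i,(x,a)}`. [folklore] -/
private theorem mulVec_blockA (R : Matrix (BellIndex mA mB oA oB) (BellIndex mA mB oA oB) ℝ)
    (x : Fin mA) (i : BellIndex mA mB oA oB) :
    (R *ᵥ blockA x) i = ∑ a, R i (.inl (x, a)) := by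
  classical
  simp only [mulVec, dotProduct, blockA, Fintype.sum_sum_type, Sum.elim_inl, Sum.elim_inr, mul_zero,
    Finset.sum_const_zero, add_zero, mul_ite, mul_one, Fintype.sum_prod_type]
  rw [Finset.sum_comm]
  simp only [Finset.sum_ite_eq', Finset.mem_univ, if_true]

/-- `(R e_{T_y})_i = Σ_b R_{i,(y,b)}`. [folklore] -/
private theorem mulVec_blockB (R : Matrix (BellIndex mA mB oA oB) (BellIndex mA mB oA oB) ℝ)
    (y : Fin mB) (i : BellIndex mA mB oA oB) :
    (R *ᵥ blockB y) i = ∑ b, R i (.inr (y, b)) := by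
  classical
  simp only [mulVec, dotProduct, blockB, Fintype.sum_sum_type, Sum.elim_inl, Sum.elim_inr, mul_zero,
    Finset.sum_const_zero, zero_add, mul_ite, mul_one, Fintype.sum_prod_type]
  rw [Finset.sum_comm]
  simp only [Finset.sum_ite_eq', Finset.mem_univ, if_true]

/-- `e_{S_x}ᵀ R e_{S_{x'}} = Σ_{a,a'} R_{(x,a),(x',a')}`. [folklore] -/
private theorem blockA_dot_mulVec_blockA (R : Matrix (BellIndex mA mB oA oB) (BellIndex mA mB oA oB) ℝ)
    (x x' : Fin mA) : blockA x ⬝ᵥ (R *ᵥ blockA x') = ∑ a, ∑ a', R (.inl (x, a)) (.inl (x', a')) := by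
  classical
  simp only [dotProduct, mulVec_blockA]
  simp only [blockA, Fintype.sum_sum_type, Sum.elim_inl, Sum.elim_inr, zero_mul, Finset.sum_const_zero,
    add_zero, ite_mul, one_mul, Fintype.sum_prod_type]
  rw [Finset.sum_comm]
  simp only [Finset.sum_ite_eq', Finset.mem_univ, if_true]

/-- `e_{T_y}ᵀ R e_{T_{y'}} = Σ_{b,b'} R_{(y,b),(y',b')}`. [folklore] -/
private theorem blockB_dot_mulVec_blockB (R : Matrix (BellIndex mA mB oA oB) (BellIndex mA mB oA oB) ℝ)
    (y y' : Fin mB) : blockB y ⬝ᵥ (R *ᵥ blockB y') = ∑ b, ∑ b', R (.inr (y, b)) (.inr (y', b')) := by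
  classical
  simp only [dotProduct, mulVec_blockB]
  simp only [blockB, Fintype.sum_sum_type, Sum.elim_inl, Sum.elim_inr, zero_mul, Finset.sum_const_zero,
    zero_add, ite_mul, one_mul, Fintype.sum_prod_type]
  rw [Finset.sum_comm]
  simp only [Finset.sum_ite_eq', Finset.mem_univ, if_true]

/-- For a real psd `R` and vectors `u, v` with `uᵀRu = uᵀRv = vᵀRv = 1`: `Ru = Rv` (the psd form of
SV Lemma 3.6 (a), `⟨k−k', k−k'⟩ = 0`). [cite: SikoraVarvitsiotis2016, Lemma 3.6 (a) (p12)] -/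
private theorem mulVec_eq_of_psd {ι : Type*} [Fintype ι] [DecidableEq ι] {R : Matrix ι ι ℝ}
    (hR : R.PosSemidef) {u v : ι → ℝ} (huu : u ⬝ᵥ (R *ᵥ u) = 1) (huv : u ⬝ᵥ (R *ᵥ v) = 1)
    (hvv : v ⬝ᵥ (R *ᵥ v) = 1) : R *ᵥ u = R *ᵥ v := by
  have hsymm : ∀ a b : ι → ℝ, a ⬝ᵥ (R *ᵥ b) = b ⬝ᵥ (R *ᵥ a) := fun a b => by
    have hRt : Rᵀ = R := by simpa [conjTranspose_eq_transpose_of_trivial] using hR.1.eq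
    rw [dotProduct_mulVec, ← mulVec_transpose, hRt, dotProduct_comm]
  have h0 : star (u - v) ⬝ᵥ (R *ᵥ (u - v)) = 0 := by
    rw [star_trivial, mulVec_sub, sub_dotProduct, dotProduct_sub, dotProduct_sub, huu, huv, hvv,
      hsymm v u, huv]
    ring
  have h := (hR.dotProduct_mulVec_zero_iff (u - v)).mp h0
  rwa [mulVec_sub, sub_eq_zero] at h

/-- **SV Theorem 3.8** (p13: "For any convex cone `𝒦 ⊆ DNN` we have that `Corr(𝒦) ⊆ NS`"), in the
form its proof gives: if some POSITIVE SEMIDEFINITE `R` lies in `𝒜(p)` then `p` is no-signaling —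
`Σ_a p(ab|xy)` does not depend on `x` and `Σ_b p(ab|xy)` does not depend on `y` (the row-block sums
`R e_{S_x}`, `R e_{T_y}` all coincide by Lemma 3.6 (a) in psd form).
[cite: SikoraVarvitsiotis2016, Thm. 3.8 (p13), Lemma 3.6 (a) (p12)] -/
theorem noSignaling_of_posSemidef_mem_behaviorAffine {p : Fin mA → Fin mB → Fin oA → Fin oB → ℝ}
    {R : Matrix (BellIndex mA mB oA oB) (BellIndex mA mB oA oB) ℝ} (hR : R ∈ behaviorAffine p)
    (hpsd : R.PosSemidef) :
    (∀ x y y' a, ∑ b, p x y a b = ∑ b, p x y' a b) ∧ (∀ x x' y b, ∑ a, p x y a b = ∑ a, p x' y a b) := by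
  classical
  obtain ⟨hsymm, h1, _, h3, h4⟩ := hR
  have hRs : ∀ i j, R j i = R i j := fun i j => by rw [← transpose_apply R i j, hsymm]
  refine ⟨fun x y y' a => ?_, fun x x' y b => ?_⟩
  · have hT : R *ᵥ blockB y = R *ᵥ blockB y' :=
      mulVec_eq_of_psd hpsd (by rw [blockB_dot_mulVec_blockB, h3])
        (by rw [blockB_dot_mulVec_blockB, h3]) (by rw [blockB_dot_mulVec_blockB, h3])
    have := congrFun hT (.inl (x, a))
    rw [mulVec_blockB, mulVec_blockB] at this
    simp only [h4] at this
    exact this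
  · have hS : R *ᵥ blockA x = R *ᵥ blockA x' :=
      mulVec_eq_of_psd hpsd (by rw [blockA_dot_mulVec_blockA, h1])
        (by rw [blockA_dot_mulVec_blockA, h1]) (by rw [blockA_dot_mulVec_blockA, h1])
    have := congrFun hS (.inr (y, b))
    rw [mulVec_blockA, mulVec_blockA] at this
    simp only [hRs, h4] at this
    exact this

/-- **SV Proposition 3.11** (p13: "For any Bell scenario we have `𝒬 ⊆ Corr(DNN) ⊆ NS`"), first
inclusion: a quantum behaviour has a DOUBLY NONNEGATIVE matrix in `𝒜(p)` (Theorem 1 and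
`CS_+ ⊆ DNN`). [cite: SikoraVarvitsiotis2016, Prop. 3.11 (p13); PrakashEtAl2017, §1.1 (p03)] -/
theorem exists_isDnn_mem_behaviorAffine_of_mem_quantumBehaviors
    {p : Fin mA → Fin mB → Fin oA → Fin oB → ℝ} (hp : p ∈ quantumBehaviors mA mB oA oB) :
    ∃ R ∈ behaviorAffine p, IsDnn R := by
  obtain ⟨R, hR, hRc⟩ := (mem_quantumBehaviors_iff p).mp hp
  exact ⟨R, hR, hRc.isDnn⟩

/-- **SV Proposition 3.11**, second inclusion `Corr(DNN) ⊆ NS`: a behaviour with a doubly nonnegative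
matrix in `𝒜(p)` is no-signaling. [cite: SikoraVarvitsiotis2016, Prop. 3.11 (p13), Thm. 3.8 (p13)] -/
theorem noSignaling_of_isDnn_mem_behaviorAffine {p : Fin mA → Fin mB → Fin oA → Fin oB → ℝ}
    {R : Matrix (BellIndex mA mB oA oB) (BellIndex mA mB oA oB) ℝ} (hR : R ∈ behaviorAffine p)
    (hdnn : IsDnn R) :
    (∀ x y y' a, ∑ b, p x y a b = ∑ b, p x y' a b) ∧ (∀ x x' y b, ∑ a, p x y a b = ∑ a, p x' y a b) :=
  noSignaling_of_posSemidef_mem_behaviorAffine hR hdnn.1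

end NoSignaling

/-! ### GdLL Theorem 5.1 and "pure states suffice in the same dimension" ([SVW16] p03) (appended) -/

section PureStates

variable {mA mB oA oB : ℕ}

/-- **Gribling–de Laat–Laurent 2017, Theorem 5.1** (p16, verbatim, "this result can be found in [SV]"):
"A function `p : A × B × S × T → [0,1]` is a quantum correlation that can be realized in local dimension
`d` [pure state `ψ ∈ ℂ^d ⊗ ℂ^d`] if and only if there exists a completely positive semidefinite matrix
`M`, with rows and columns indexed by the disjoint union `(A × S) ⊔ (B × T)`, satisfying
`cpsd-rank_ℂ(M) ≤ d`, `M_{(a,s),(b,t)} = p(a,b|s,t)` for all `a, b, s, t`, and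
`Σ_{a,b} M_{(a,s),(b,t)} = Σ_{a,a'} M_{(a,s),(a',s')} = Σ_{b,b'} M_{(b,t),(b',t')} = 1` for all `s,s',t,t'`."
Typed over `BellIndex` (pairs written `(s,a)`; the symmetric-matrix convention of `𝒜(p)` is automatic
for cpsd `M`) and for `d ≥ 1`. [cite: GriblingDelaatLaurent2017, Thm. 5.1 (p16); SikoraVarvitsiotis2016,
Thm. 3.2 + Rem. 3.3 (p11)] -/
theorem GriblingDelaatLaurent2017_thm51 {p : Fin mA → Fin mB → Fin oA → Fin oB → ℝ} {d : ℕ}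
    (hd : 0 < d) : HasPureQuantumRep p d ↔ ∃ R ∈ behaviorAffine p, HasCpsdFactorization R d :=
  ⟨fun h => exists_cpsd_of_hasQuantumRep h.hasQuantumRep,
    fun ⟨_, hR, hRd⟩ => hasPureQuantumRep_of_cpsd hd hR hRd⟩

/-- **Pure states suffice in the same dimension** ([SVW16] p03, verbatim: "without loss of generality,
we can assume Alice and Bob share a pure state on the Hilbert space `ℂ^d ⊗ ℂ^d`"; printed proof by
purification and a Schmidt-basis compression — here through the cpsd dictionary: a density-matrix
representation of dimension `d` gives cpsd factors of size `d`, which give back the pure state `vec(K)`).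
[cite: SikoraVarvitsiotisWei2016, p03; SikoraVarvitsiotis2016, Thm. 3.2 (p11)] -/
theorem hasPureQuantumRep_iff_hasQuantumRep {p : Fin mA → Fin mB → Fin oA → Fin oB → ℝ} {d : ℕ} :
    HasPureQuantumRep p d ↔ HasQuantumRep p d := by
  refine ⟨HasPureQuantumRep.hasQuantumRep, fun h => ?_⟩
  rcases Nat.eq_zero_or_pos d with rfl | hd
  · exact absurd h (not_hasQuantumRep_zero p)
  · obtain ⟨R, hR, hRd⟩ := exists_cpsd_of_hasQuantumRep h
    exact hasPureQuantumRep_of_cpsd hd hR hRd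

/-- `𝒟(p)` is also the least dimension of a PURE-state representation (PSVW's `𝒟` = GdLL's smallest
local dimension). [cite: SikoraVarvitsiotisWei2016, p03; GriblingDelaatLaurent2017, §5 (p16)] -/
theorem hasPureQuantumRep_quantumDim {p : Fin mA → Fin mB → Fin oA → Fin oB → ℝ}
    (hp : p ∈ quantumBehaviors mA mB oA oB) : HasPureQuantumRep p (quantumDim p) :=
  hasPureQuantumRep_iff_hasQuantumRep.mpr (hasQuantumRep_quantumDim hp)

end PureStates

end Literature.Combinatorics.Optimization
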